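import Literature.InformationTheory.QuantumCodes.TwoBlockCodeDimension
import Literature.InformationTheory.QuantumCodes.ParityCheckDuality
import Literature.InformationTheory.Coding.GilbertVarshamovDual
import HarnessLib

/-!
# Distance bounds for two-block CSS codes over a field (Lin–Pryadko 2024, §III.B–C): Statements 3, 4, 5
# and the `d_Z` identity, proved in intrinsic form — with a kernel counterexample to Statement 5 as printed

Source followed: H.-K. Lin, L. P. Pryadko, *Quantum two-block group algebra codes*, Phys. Rev. A **109**
(2024) 022407 = arXiv:2306.16400 [LinPryadko2024]; held text `paper:arxiv-2306.16400` (arXiv TeX): §II.B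
subsystem CSS codes (chunk p0005 L74–114), §III (p0006 L1–30), §III.B "Upper distance bounds" and §III.C
"Lower distance bounds" (chunk p0007 L1–160), App. A proofs §VII.C–F (chunk p0016 L38–112, p0017 L1–26).
This file continues `TwoBlockCodeDimension.lean` (§III.A: `H_X = (A,B)`, `H_Zᵀ = (B; −A)`, `col`, `k_S`,
the intrinsic rank defects `δ_X = dim(col A ∩ col B) − rank(AB)`, `δ_Z = dim(row A ∩ row B) − rank(AB)`,
admissible idempotents `IsLeftIdem E_A A` / `IsRightIdem F_A A`), whose scope note listed Statements 3–5
and the `d_Z` identities as NOT typed.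

## Setting and the printed statements (p0006–p0007)

`A, B ∈ M_ℓ(F)` square and commuting; `Z`-codewords `c = (u; v)` with `Au + Bv = 0`; trivial ones
`(Bs; −As)`; "the subsystem block-erasure code `css(A,Bᵀ)` and its CSS-dual, obtained by erasing the qudits
in the right and left blocks, respectively. We will denote the common parameters of these codes as
`[[ℓ, k_S, d_S]]_q`, and `p⋆ ≡ rank(AB)`" (eq. (13), p0006 L17–26); subsystem distance
"`d_Z = min_{c ∈ C_{H_X}^⊥ ∖ C_{G_Z}} wgt c = min_{c ∈ C_{G_X}^⊥ ∖ C_{G_Z}} wgt c`" (eq. (8), p0005 L100–105;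
`H_X` = the `X`-stabilizers, `G_X, G_Z` = the gauge generators).
* **Statement 3** (p0007 L51–63): for `μ ∈ {L,R}`, `d_Z(Q) ≤ d_Z(Q'_μ) ≤ d_Z(Q''_μ) ≤ d(C_μ)` with
  `Q'_L = css(H_X^{(L)}, H_Z)`, `H_X^{(L)} = [[A, B],[0, I − E_A]]`; `Q''_L = css(A, (H_Z)_L)`,
  `(H_Z)_Lᵀ = B(I − F_A)`; `C_L` with parity-check matrix `H_L = [A; E_B]`.
* **Statement 4** (p0007 L71–76): "Suppose matrix `A` is block-diagonal with the maximum block size `m`, and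
  the code `Q''_L` is non-trivial, `k(Q''_L) > 0`. Then the distance `d_Z(Q''_L) ≤ m`."
* §III.C (p0007 L98–120): the `Z`-punctured stabilizer codes `css((1−E_B)A, Bᵀ)` and `css((1−E_A)B, Aᵀ)`
  (eq. (24)) "both have the dimension `k_S + δ_X`"; **Statement 5** (p0007 L121–129): "Suppose both rank
  defects … are zero, `δ_X = δ_Z = 0`. Then `d ≥ d_S`, `d_S ≡ d(A,Bᵀ)`."
* the `d_Z` identity (eq. (25), p0007 L143–160; proof p0017 L1–26): `d_Z = min{d_Z(H_X^{(μ)}, H_Z),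
  d_Z(H_X, H_Z^{(μ)})}`, `H_Z^{(L)} = [[B, I−F_A],[−A, 0]]ᵀ`.

## What is PROVED here (every declaration is a theorem or a kernel-decided example; no named facts)

All auxiliary codes are written INTRINSICALLY (choice-free) and identified with the printed matrices for
every admissible idempotent: `ker(I − E_A) = col A` (`IsLeftIdem.ker_one_sub`), `col(B(I − F_A)) = B(ker A)`
(`IsRightIdem.col_mul_one_sub`), `ker F_A = ker A` (`IsRightIdem.ker_eq`), `ker((I − E_B)A) = A⁻¹(col B)`
(`IsLeftIdem.ker_one_sub_mul`), `ker [A; E_B] = ker A ∩ ker E_B` (`ker_fromRows`).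
* **Statement 3** (`μ = L`; `μ = R` is the same statement for the pair `(B, A)`): the three inclusions of
  the printed proof, as maps of non-trivial codewords preserving (or not increasing) the weight —
  `statement3a`, `statement3b` (`u ∈ ker A ∖ B(ker A)` ⟹ `(u;0)` is a non-trivial `Z`-codeword of `Q'_L`,
  hence of `Q`), `statement3c` (`0 ≠ u ∈ ker A ∩ ker E_B` ⟹ `u ∉ B(ker A)`, for EVERY admissible `E_B`);
  packaged: `cssMinDist_le_of_mem_ker_not_mem_map` (`d(Q) ≤ wgt u`).
* **Statement 4**: `statement4` — if `A` is block-diagonal for a block labelling `blk : ι → β`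
  (`blk i ≠ blk j ⟹ A i j = 0`) and `Q''_L` is non-trivial (some `u ∈ ker A ∖ B(ker A)`), then there is such
  a `u` supported inside ONE block, so `d_Z(Q''_L) ≤ m` and `d(Q) ≤ m` for `m` the maximum block size
  (`cssMinDist_le_blockSize`). (Proof as printed: block restrictions of kernel vectors are kernel vectors.)
* **the `d_Z` identity (25)**: `dZ_dichotomy` — a non-trivial `Z`-codeword `c = (u;v)` of `Q` either has
  `v ∈ col A` (then it is a non-trivial codeword of `Q₁ = Q'_L`) or is non-trivial in
  `Q₂ = css(H_X, H_Z^{(L)})`, whose trivial space is `rs H_Z + (ker A ⊕ 0)` (`trivial_Q2_printed_iff`); and conversely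
  (`nontrivial_of_Q1`, `nontrivial_of_Q2`). The printed dimension claims `k₁ = k_S + δ_Z`:
  `finrank_ker_inf_ker_eq` (`dim(ker A ∩ ker B) = k_S + δ_Z`).
* **§III.C, intrinsic characterisations of vanishing defects** (new, choice-free, and the actual content of
  the hypothesis of Statement 5): `defectZ_eq_zero_iff` — **`δ_Z = 0 ⟺ ker(AB) = ker A + ker B`**;
  `defectX_eq_zero_iff` — **`δ_X = 0 ⟺ col(AB) = col A ∩ col B`**.
* **Statement 5, corrected and proved** (`statement5_Z`, `statement5_X`, `LinPryadko2024_statement5`):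
  if `δ_Z = 0`, every non-trivial `Z`-codeword `(u;v)` of `Q` restricts to a non-trivial `Z`-codeword of one
  of the two `Z`-punctured codes (24): `u ∈ A⁻¹(col B) ∖ col B` or `v ∈ B⁻¹(col A) ∖ col A`; if moreover
  `δ_X = 0` then `A⁻¹(col B) = ker A + col B` (`comap_col_eq_ker_sup_col`), which IS the dressed `Z`-logical
  space `C_{H_X}^⊥` of the erasure subsystem code `css(A, Bᵀ)` (gauge group `G_X = rs A`, `G_Z = rs Bᵀ =
  col B`; `X`-stabilizers `rs A ∩ (col B)^⊥`; `dualCode_xStab_erasure`: `(rs A ∩ (col B)^⊥)^⊥ = ker A + col B`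
  — eq. (8), FIRST expression); the `X`-sector likewise with the roles of `δ_X`, `δ_Z` exchanged. Hence, with
  `δ_X = δ_Z = 0`: **`d(Q) ≥ min(d_S(css(A,Bᵀ)), d_S(css(B,Aᵀ)))`**, both single-block erasure codes, dressed
  distances (`LinPryadko2024_statement5`: a common lower bound `D` of the four dressed sector distances is
  `≤ cssMinDist H_X H_Z`).

## What FAILS as printed (kernel counterexamples over `𝔽₂`)

* `statement5_asPrinted_counterexample` (`ℓ = 4`): `A` with rows `(1111),(0110),(1001),(1111)`, `B` with
  all rows `(1110)`: `AB = BA = 0` (so `p⋆ = 0` and both erasure codes are honest stabilizer codes — the case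
  in which the text expects the bound to SATURATE, p0007 L135–139), `δ_X = δ_Z = 0` (`col A ∩ col B = 0`,
  `row A ∩ row B = 0`, by explicit certificates); the two-block code has the weight-ONE non-trivial `Z`-codeword
  `(0; e₃)` so `d ≤ 1`, while EVERY dressed logical of `css(A,Bᵀ)` (both sectors) has weight `≥ 2` and one has
  weight `2`: `d = 1 < 2 = d(A,Bᵀ) = d_S`. So "the common parameters `[[ℓ,k_S,d_S]]`"
  of eq. (13) do not exist in general (`css(B,Aᵀ)` has distance `1` here: `e₃ ∈ ker B ∖ col A`), and
  Statement 5 with `d_S ≡ d(A,Bᵀ)` read literally is false; it holds with the minimum over BOTH erasure codes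
  (proved above), which is what the printed proof (§VII.E, p0016 L90–112: "repeated identically for the second
  code … up to an interchange of the `A` and `B` matrices") actually shows.
* `eq8_dressed_ne_bare` (`ℓ = 2`, `A = B =` rows `(00),(11)`, commuting, inside a two-block code): for the
  erasure code `css(A,Bᵀ)` the two minima of eq. (8) differ — `min_{C_{H_X}^⊥ ∖ C_{G_Z}} wgt = 1`
  (dressed: `e₀ ∈ (ker A + col B) ∖ col B`) but `min_{C_{G_X}^⊥ ∖ C_{G_Z}} wgt = 2` (bare: `ker A ∖ col B =
  {(1,1)}`): the second equality of (8) is false in general (dressed ≤ bare always, `bare ⊆ dressed`).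

Scope: general field `F` throughout (weights = `hammingNorm`); the printed dimension counts are ALL typed: `k₁`'s
`dim(ker A ∩ ker B) = k_S + δ_Z` (`finrank_ker_inf_ker_eq`), eq. (24)'s "both have the dimension `k_S + δ_X`" (appended
section `EqTwentyFour`: `eq24_dim_left/right`, for every admissible idempotent), and App. A.6's "rank `H_Z^{(L)} = ℓ`",
`k₂ = k_S + δ_X`, `k₁ + k₂ = k` (appended section `AppASix`: `finrank_rowSpace_HZ_sup_kerLeft`, `finrank_pcCode_HX_eq_k2`,
`k1_add_k2_eq_dim`); `μ = R` versions are the `μ = L` versions for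
`(B, A)` (the two-block code of `(B,A)` is the block swap of that of `(A,B)`; not re-stated). The binary
`CSSCode` packaging for `TwoBlockGA.css` / `AbelianTwoBlock.css` is immediate from `TwoBlock.HX_leftMul_rightMul`
etc. and is left to users. Equation numbers are those of the arXiv TeX (labels quoted in the cites).
-/

namespace Literature.InformationTheory.QuantumCodes

namespace TwoBlock

open Matrix Module
open Literature.InformationTheory.Coding (dualCode mem_dualCode_iff hammingNorm_sumElim)

variable {F : Type*} [Field F] {ι : Type*} [Fintype ι]

/-! ### `Z`-codewords and `Z`-stabilizers of the two-block code -/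

section Codewords

/-- `c = (u;v)` is a `Z`-codeword of the two-block code iff `Au + Bv = 0`.
[cite: LinPryadko2024, §III.B "a given non-trivial codeword `c_Z ≡ (u; v)`" with §II.B `Q_Z = C_{H_X}^⊥` (arXiv:2306.16400 chunks p0007 L3, p0005 L40–55)] -/
theorem mem_pcCode_HX_iff (A B : Matrix ι ι F) (u v : ι → F) :
    Sum.elim u v ∈ pcCode (HX A B) ↔ A *ᵥ u + B *ᵥ v = 0 := by
  rw [mem_pcCode_iff, HX_def, fromCols_mulVec_sumElim]

/-- The `Z`-stabilizers (row space of `H_Z = (Bᵀ, −Aᵀ)`) are exactly the vectors `(Bs; −As)`.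
[cite: LinPryadko2024, §III eq. `H_Zᵀ = (B; −A)` (tex label eq:css-blocks; arXiv:2306.16400 chunk p0006 L6–10)] -/
theorem mem_rowSpace_HZ_iff (A B : Matrix ι ι F) (u v : ι → F) :
    Sum.elim u v ∈ rowSpace (HZ A B) ↔ ∃ s, B *ᵥ s = u ∧ -(A *ᵥ s) = v := by
  rw [mem_rowSpace_iff, HZ_def]
  constructor
  · rintro ⟨s, hs⟩
    rw [vecMul_fromCols, vecMul_transpose, vecMul_neg, vecMul_transpose] at hs
    exact ⟨s, by simpa using congrArg (· ∘ Sum.inl) hs, by simpa using congrArg (· ∘ Sum.inr) hs⟩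
  · rintro ⟨s, hu, hv⟩
    refine ⟨s, ?_⟩
    rw [vecMul_fromCols, vecMul_transpose, vecMul_neg, vecMul_transpose, hu, hv]

/-- The `X`-codewords: `(u;v) ∈ ker H_Z ⟺ Bᵀu = Aᵀv`. [cite: LinPryadko2024, §II.B `Q_X = C_{H_Z}^⊥ ∖ C_{H_X}` (arXiv:2306.16400 chunk p0005 L40–55)] -/
theorem mem_pcCode_HZ_iff (A B : Matrix ι ι F) (u v : ι → F) :
    Sum.elim u v ∈ pcCode (HZ A B) ↔ Bᵀ *ᵥ u = Aᵀ *ᵥ v := by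
  rw [mem_pcCode_iff, HZ_def, fromCols_mulVec_sumElim, neg_mulVec, ← sub_eq_add_neg, sub_eq_zero]

/-- The `X`-stabilizers (row space of `H_X = (A, B)`) are the vectors `(Aᵀt; Bᵀt)`.
[cite: LinPryadko2024, §III eq. `H_X = (A,B)` (tex label eq:css-blocks; arXiv:2306.16400 chunk p0006 L6–10)] -/
theorem mem_rowSpace_HX_iff (A B : Matrix ι ι F) (u v : ι → F) :
    Sum.elim u v ∈ rowSpace (HX A B) ↔ ∃ t, Aᵀ *ᵥ t = u ∧ Bᵀ *ᵥ t = v := by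
  rw [mem_rowSpace_iff, HX_def]
  constructor
  · rintro ⟨t, ht⟩
    rw [vecMul_fromCols] at ht
    exact ⟨t, by rw [mulVec_transpose]; simpa using congrArg (· ∘ Sum.inl) ht,
      by rw [mulVec_transpose]; simpa using congrArg (· ∘ Sum.inr) ht⟩
  · rintro ⟨t, hu, hv⟩
    refine ⟨t, ?_⟩
    rw [vecMul_fromCols, ← mulVec_transpose, ← mulVec_transpose, hu, hv]

variable [DecidableEq F]

/-- `wgt (u; v) = wgt u + wgt v`. [folklore] -/
private theorem hammingNorm_sumElim' (u v : ι → F) :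
    hammingNorm (Sum.elim u v) = hammingNorm u + hammingNorm v :=
  hammingNorm_sumElim u v

end Codewords

/-! ### Admissible idempotents: the printed auxiliary matrices are the intrinsic subspaces -/

section IdemSpaces

variable [DecidableEq ι]

/-- For an admissible `E_A`: `ker(I − E_A) = col A` ("`(1 − E_A)v = 0` … implies `v = As`").
[cite: LinPryadko2024, App. A.6 proof of eq. (25) "(1−E_A) v = 0. This implies v = A s" (arXiv:2306.16400 chunk p0017 L17–19)] -/
theorem IsLeftIdem.ker_one_sub {E A : Matrix ι ι F} (h : IsLeftIdem E A) :
    LinearMap.ker (1 - E).mulVecLin = col A := by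
  rw [← h.col_eq]
  ext v
  simp only [LinearMap.mem_ker, Matrix.mulVecLin_apply, sub_mulVec, one_mulVec, sub_eq_zero]
  constructor
  · intro hv
    exact ⟨v, by rw [Matrix.mulVecLin_apply, ← hv]⟩
  · rintro ⟨w, rfl⟩
    rw [Matrix.mulVecLin_apply, mulVec_mulVec, h.idem]

omit [DecidableEq ι] in
/-- For an admissible `F_A`: `ker F_A = ker A` (`A = A F_A` and equal ranks). [cite: LinPryadko2024, §III.A (tex label eq:idempotent-EA-FA; arXiv:2306.16400 chunk p0006 L33–40)] -/
theorem IsRightIdem.ker_eq {P A : Matrix ι ι F} (h : IsRightIdem P A) :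
    LinearMap.ker P.mulVecLin = LinearMap.ker A.mulVecLin := by
  apply Submodule.eq_of_le_of_finrank_eq
  · intro v hv
    rw [LinearMap.mem_ker, Matrix.mulVecLin_apply] at hv ⊢
    rw [← h.mul_eq, ← mulVec_mulVec, hv, mulVec_zero]
  · have h1 := LinearMap.finrank_range_add_finrank_ker P.mulVecLin
    have h2 := LinearMap.finrank_range_add_finrank_ker A.mulVecLin
    have h3 : finrank F ↥(LinearMap.range P.mulVecLin) = finrank F ↥(LinearMap.range A.mulVecLin) := by
      change P.rank = A.rank
      exact h.rank_eq
    omega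

/-- For an admissible `F_A`: `col(I − F_A) = ker A`. [cite: LinPryadko2024, §III.B `(H_Z)_Lᵀ = B(I − F_A)` (tex label eq:mat-HZ-shortened; arXiv:2306.16400 chunk p0007 L22–27)] -/
theorem IsRightIdem.col_one_sub {P A : Matrix ι ι F} (h : IsRightIdem P A) :
    col (1 - P) = LinearMap.ker A.mulVecLin := by
  rw [← h.ker_eq]
  apply le_antisymm
  · rintro _ ⟨v, rfl⟩
    rw [LinearMap.mem_ker, Matrix.mulVecLin_apply, Matrix.mulVecLin_apply, mulVec_mulVec, Matrix.mul_sub,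
      Matrix.mul_one, h.idem, sub_self, zero_mulVec]
  · intro v hv
    rw [LinearMap.mem_ker, Matrix.mulVecLin_apply] at hv
    exact ⟨v, by rw [Matrix.mulVecLin_apply, sub_mulVec, one_mulVec, hv, sub_zero]⟩

/-- For an admissible `F_A`: `col(B(I − F_A)) = B(ker A)` — the row space of the printed `(H_Z)_L`,
`(H_Z)_Lᵀ = B(I − F_A)`, is the intrinsic subspace `B(ker A)`.
[cite: LinPryadko2024, §III.B (tex label eq:mat-HZ-shortened; arXiv:2306.16400 chunk p0007 L22–27)] -/
theorem IsRightIdem.col_mul_one_sub {P A : Matrix ι ι F} (h : IsRightIdem P A) (B : Matrix ι ι F) :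
    col (B * (1 - P)) = (LinearMap.ker A.mulVecLin).map B.mulVecLin := by
  rw [← h.col_one_sub, col, col, Matrix.mulVecLin_mul, LinearMap.range_comp]

/-- For an admissible `E_B`: `ker((I − E_B)A) = A⁻¹(col B)` — the `Z`-codewords of the printed
`Z`-punctured code `css((1−E_B)A, Bᵀ)` of eq. (24) are the `u` with `Au ∈ col B`.
[cite: LinPryadko2024, §III.C eq. (24) `css((1−E_B)A, Bᵀ)` (tex label eq:Z-punctured; arXiv:2306.16400 chunk p0007 L98–103)] -/
theorem IsLeftIdem.ker_one_sub_mul {E B : Matrix ι ι F} (h : IsLeftIdem E B) (A : Matrix ι ι F) :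
    LinearMap.ker ((1 - E) * A).mulVecLin = (col B).comap A.mulVecLin := by
  rw [← h.ker_one_sub, Matrix.mulVecLin_mul, LinearMap.ker_comp]

omit [DecidableEq ι] in
/-- For an admissible `E_B`: `ker [A; E_B] = ker A ∩ ker E_B` (the classical code `C_L` with parity-check
matrix `H_L = [A; E_B]`). [cite: LinPryadko2024, §III.B `H_L ≡ [A; E_B], H_R ≡ [B; E_A]` (tex label eq:HL-HR; arXiv:2306.16400 chunk p0007 L29–34)] -/
theorem ker_fromRows (A E : Matrix ι ι F) :
    LinearMap.ker (fromRows A E).mulVecLin = LinearMap.ker A.mulVecLin ⊓ LinearMap.ker E.mulVecLin := by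
  ext v
  simp only [LinearMap.mem_ker, Matrix.mulVecLin_apply, fromRows_mulVec, Submodule.mem_inf]
  constructor
  · intro hv
    exact ⟨by simpa using congrArg (· ∘ Sum.inl) hv, by simpa using congrArg (· ∘ Sum.inr) hv⟩
  · rintro ⟨h1, h2⟩
    rw [h1, h2]
    funext x
    rcases x with x | x <;> rfl

end IdemSpaces

/-! ### Statement 3: the chain `d_Z(Q) ≤ d_Z(Q'_L) ≤ d_Z(Q''_L) ≤ d(C_L)` as maps of codewords -/

section StatementThree

/-- **Statement 3 (a).** A `Z`-codeword of `Q'_L = css(H_X^{(L)}, H_Z)` — i.e. `(u;v)` with `Au + Bv = 0`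
and `v ∈ col A` (`= ker(I − E_A)`) — is a `Z`-codeword of `Q`; the trivial codewords are the same (`rs H_Z`),
so non-trivial ones stay non-trivial and `d_Z(Q) ≤ d_Z(Q'_L)`.
[cite: LinPryadko2024, Statement 3 (a) and App. A.3 "(a) The additional row block in matrix H_X^{(L)} … guarantees that any Z-like codeword in Q_L' is also a Z-like codeword" (arXiv:2306.16400 chunks p0007 L51–60, p0016 L38–47)] -/
theorem statement3a {A B : Matrix ι ι F} {u v : ι → F} (h : A *ᵥ u + B *ᵥ v = 0)
    (_hv : v ∈ col A) (hnt : Sum.elim u v ∉ rowSpace (HZ A B)) :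
    Sum.elim u v ∈ pcCode (HX A B) ∧ Sum.elim u v ∉ rowSpace (HZ A B) :=
  ⟨(mem_pcCode_HX_iff A B u v).2 h, hnt⟩

/-- **Statement 3 (b).** A non-trivial `Z`-codeword `u` of the single-block `Z`-shortened code
`Q''_L = css(A, (H_Z)_L)` — `Au = 0`, `u ∉ B(ker A)` (`= rs (H_Z)_L`) — pads to the non-trivial codeword
`(u; 0)` of `Q'_L` (and of `Q`): `v = 0 ∈ col A`, and `(u;0) = (Bs; −As)` would force `As = 0`, `u = Bs`.
[cite: LinPryadko2024, Statement 3 (b) and App. A.3 "(b) Any non-trivial Z-codeword u in Q_L'' is also a non-trivial codeword (u; 0) in Q_L'" (arXiv:2306.16400 chunks p0007 L51–60, p0016 L47–49)] -/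
theorem statement3b {A B : Matrix ι ι F} {u : ι → F} (hu : A *ᵥ u = 0)
    (hu' : u ∉ (LinearMap.ker A.mulVecLin).map B.mulVecLin) :
    Sum.elim u 0 ∈ pcCode (HX A B) ∧ (0 : ι → F) ∈ col A ∧ Sum.elim u 0 ∉ rowSpace (HZ A B) := by
  refine ⟨(mem_pcCode_HX_iff A B u 0).2 (by rw [hu, mulVec_zero, add_zero]), Submodule.zero_mem _, ?_⟩
  intro h
  obtain ⟨s, hs, hs'⟩ := (mem_rowSpace_HZ_iff A B u 0).1 h
  apply hu'
  refine ⟨s, ?_, hs⟩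
  change A *ᵥ s = 0
  exact neg_eq_zero.1 hs'

/-- **Statement 3 (c).** For EVERY admissible `E_B`: a non-zero word `u` of the classical code `C_L`
(`Au = 0`, `E_B u = 0`) is a non-trivial `Z`-codeword of `Q''_L`: "The condition `E_B u = 0` guarantees that
`u ≠ 0` cannot be set to zero by adding linear combinations of the rows of `(H_Z)_L`" — indeed `u ∉ col B`
since `col B = col E_B` meets `ker E_B` trivially.
[cite: LinPryadko2024, Statement 3 (c) and App. A.3 (arXiv:2306.16400 chunks p0007 L51–60, p0016 L49–54)] -/
theorem statement3c {A B E : Matrix ι ι F} (hE : IsLeftIdem E B) {u : ι → F} (_hu : A *ᵥ u = 0)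
    (huE : E *ᵥ u = 0) (hu0 : u ≠ 0) : u ∉ (LinearMap.ker A.mulVecLin).map B.mulVecLin := by
  rintro ⟨s, -, rfl⟩
  rw [Matrix.mulVecLin_apply] at huE hu0
  have h1 : E *ᵥ (B *ᵥ s) = B *ᵥ s := by rw [mulVec_mulVec, hE.mul_eq]
  exact hu0 (by rw [← h1, huE])

variable [DecidableEq F]

/-- The chain packaged for the Tillich–Zémor distance of `Q`: every `u ∈ ker A ∖ B(ker A)` bounds
`d(Q) ≤ d_Z(Q) ≤ wgt u` (Statement 3 (a)+(b); `wgt (u;0) = wgt u`).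
[cite: LinPryadko2024, Statement 3 "This implies the inequality d_Z ≤ d_Z(Q_μ'')" (arXiv:2306.16400 chunk p0007 L61–63)] -/
theorem cssMinDist_le_of_mem_ker_not_mem_map {A B : Matrix ι ι F} {u : ι → F}
    (hu : A *ᵥ u = 0) (hu' : u ∉ (LinearMap.ker A.mulVecLin).map B.mulVecLin) :
    cssMinDist (HX A B) (HZ A B) ≤ (hammingNorm u : ℕ∞) := by
  obtain ⟨h1, -, h3⟩ := statement3b hu hu'
  have h := cssMinDist_le_hammingNorm (HX := HX A B) (HZ := HZ A B) (Or.inl ⟨h1, h3⟩)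
  rwa [hammingNorm_sumElim', hammingNorm_zero, add_zero] at h

/-- Statement 3 (c) packaged: a non-zero `u ∈ C_L = ker A ∩ ker E_B` (any admissible `E_B`) gives
`d(Q) ≤ wgt u`, i.e. `d(Q) ≤ d(C_L)`. [cite: LinPryadko2024, Statement 3 (arXiv:2306.16400 chunk p0007 L51–63)] -/
theorem cssMinDist_le_of_mem_CL {A B E : Matrix ι ι F} (hE : IsLeftIdem E B)
    {u : ι → F} (hu : A *ᵥ u = 0) (huE : E *ᵥ u = 0) (hu0 : u ≠ 0) :
    cssMinDist (HX A B) (HZ A B) ≤ (hammingNorm u : ℕ∞) :=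
  cssMinDist_le_of_mem_ker_not_mem_map hu (statement3c hE hu huE hu0)

end StatementThree

/-! ### Statement 4: block-diagonal `A` -/

section StatementFour

variable {β : Type*} [DecidableEq β]

/-- The restriction of a vector to the block labelled `b`. [cite: LinPryadko2024, App. A.4 "we can choose a set of basis vectors … so that the support of each vector fits entirely in a single block" (arXiv:2306.16400 chunk p0016 L57–60)] -/
def blockRestrict (blk : ι → β) (b : β) (u : ι → F) : ι → F := fun i => if blk i = b then u i else 0

omit [Fintype ι] in
/-- Unfolding lemma. [cite: LinPryadko2024, App. A.4 (arXiv:2306.16400 chunk p0016 L57–60)] -/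
theorem blockRestrict_apply (blk : ι → β) (b : β) (u : ι → F) (i : ι) :
    blockRestrict blk b u i = if blk i = b then u i else 0 := rfl

omit [Fintype ι] in
/-- A block restriction is supported inside its block. [cite: LinPryadko2024, App. A.4 (arXiv:2306.16400 chunk p0016 L57–60)] -/
theorem blockRestrict_eq_zero_of_ne (blk : ι → β) {b : β} (u : ι → F) {i : ι} (hi : blk i ≠ b) :
    blockRestrict blk b u i = 0 := if_neg hi

/-- For a block-diagonal `A` (`A i j = 0` unless `i, j` lie in the same block) the block restrictions of a
kernel vector are kernel vectors. [cite: LinPryadko2024, App. A.4 proof of Statement 4 (arXiv:2306.16400 chunk p0016 L55–68)] -/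
theorem mulVec_blockRestrict_eq_zero {A : Matrix ι ι F} {blk : ι → β}
    (hA : ∀ i j, blk i ≠ blk j → A i j = 0) {u : ι → F} (hu : A *ᵥ u = 0) (b : β) :
    A *ᵥ blockRestrict blk b u = 0 := by
  funext i
  have hi := congr_fun hu i
  simp only [mulVec, dotProduct, Pi.zero_apply] at hi ⊢
  by_cases hb : blk i = b
  · rw [← hi]
    refine Finset.sum_congr rfl fun j _ => ?_
    by_cases hj : blk j = b
    · rw [blockRestrict_apply, if_pos hj]
    · rw [blockRestrict_apply, if_neg hj, hA i j (by rw [hb]; exact Ne.symm hj), zero_mul, zero_mul]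
  · refine Finset.sum_eq_zero fun j _ => ?_
    by_cases hj : blk j = b
    · rw [hA i j (by rw [hj]; exact hb), zero_mul]
    · rw [blockRestrict_apply, if_neg hj, mul_zero]

/-- A vector is the sum of its block restrictions. [cite: LinPryadko2024, App. A.4 "Since u is a linear combination of the basis vectors" (arXiv:2306.16400 chunk p0016 L64–66)] -/
theorem sum_blockRestrict (blk : ι → β) (u : ι → F) :
    ∑ b ∈ Finset.univ.image blk, blockRestrict blk b u = u := by
  funext i
  rw [Finset.sum_apply]
  simp [blockRestrict_apply]

/-- **Statement 4 (single-block witness).** If `A` is block-diagonal and `Q''_L` is non-trivial — some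
`u ∈ ker A` is not in `B(ker A)` — then some block restriction `u_b ∈ ker A ∖ B(ker A)`: otherwise all
restrictions lie in the subspace `B(ker A)` and so does their sum `u`.
[cite: LinPryadko2024, Statement 4 and App. A.4 "at least one of these satisfies the equation (I−E_B)u_j ≠ 0, which gives the upper bound in question, d_Z(A,Bᵀ) ≤ wgt u_j ≤ m" (arXiv:2306.16400 chunks p0007 L71–76, p0016 L55–68)] -/
theorem statement4 {A B : Matrix ι ι F} {blk : ι → β} (hA : ∀ i j, blk i ≠ blk j → A i j = 0)
    {u : ι → F} (hu : A *ᵥ u = 0) (hu' : u ∉ (LinearMap.ker A.mulVecLin).map B.mulVecLin) :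
    ∃ b, A *ᵥ blockRestrict blk b u = 0 ∧
      blockRestrict blk b u ∉ (LinearMap.ker A.mulVecLin).map B.mulVecLin := by
  by_contra hnone
  push Not at hnone
  apply hu'
  rw [← sum_blockRestrict blk u]
  exact Submodule.sum_mem _ fun b _ => hnone b (mulVec_blockRestrict_eq_zero hA hu b)

variable [DecidableEq F]

/-- The weight of a block restriction is at most the block size. [cite: LinPryadko2024, App. A.4 "which implies wgt(u_j) ≤ m" (arXiv:2306.16400 chunk p0016 L60–61)] -/
theorem hammingNorm_blockRestrict_le (blk : ι → β) (b : β) (u : ι → F) :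
    hammingNorm (blockRestrict blk b u) ≤ (Finset.univ.filter fun i => blk i = b).card := by
  unfold hammingNorm
  refine Finset.card_le_card fun i hi => ?_
  simp only [Finset.mem_filter, Finset.mem_univ, true_and] at hi ⊢
  by_contra hb
  exact hi (blockRestrict_eq_zero_of_ne blk u hb)

/-- **Statement 4 (as printed): `d_Z(Q''_L) ≤ m`, hence `d(Q) ≤ m`,** for `A` block-diagonal with maximum
block size `m` and `Q''_L` non-trivial. [cite: LinPryadko2024, Statement 4 "Suppose matrix A is block-diagonal with the maximum block size m, and the code Q_L'' is non-trivial, k(Q_L'') > 0. Then the distance d_Z(Q_L'') ≤ m" (arXiv:2306.16400 chunk p0007 L71–76)] -/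
theorem cssMinDist_le_blockSize {A B : Matrix ι ι F} {blk : ι → β}
    (hA : ∀ i j, blk i ≠ blk j → A i j = 0) {m : ℕ} (hm : ∀ b, (Finset.univ.filter fun i => blk i = b).card ≤ m)
    (hk : ∃ u, A *ᵥ u = 0 ∧ u ∉ (LinearMap.ker A.mulVecLin).map B.mulVecLin) :
    cssMinDist (HX A B) (HZ A B) ≤ (m : ℕ∞) := by
  obtain ⟨u, hu, hu'⟩ := hk
  obtain ⟨b, hb, hb'⟩ := statement4 hA hu hu'
  exact (cssMinDist_le_of_mem_ker_not_mem_map hb hb').trans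
    (Nat.cast_le.2 ((hammingNorm_blockRestrict_le blk b u).trans (hm b)))

end StatementFour

/-! ### The `d_Z` identity (25): the dichotomy `Q₁ = css(H_X^{(L)}, H_Z)` / `Q₂ = css(H_X, H_Z^{(L)})` -/

section DZIdentity

/-- **Dichotomy, first half.** A non-trivial `Z`-codeword `(u;v)` of `Q` with `v ∈ col A` is a (non-trivial)
codeword of `Q₁ = Q'_L`; one with `v ∉ col A` is non-trivial in `Q₂`, i.e. not of the form `(Bs + a; −As)`
with `Aa = 0` ("any linear combination of the columns of `H_Z^{(L)}` cannot modify the value of `(1−E_A)v`").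
[cite: LinPryadko2024, eq. (25) and its proof App. A.6 (arXiv:2306.16400 chunks p0007 L143–152, p0017 L1–26)] -/
theorem dZ_dichotomy {A B : Matrix ι ι F} {u v : ι → F} (_h : A *ᵥ u + B *ᵥ v = 0)
    (_hnt : Sum.elim u v ∉ rowSpace (HZ A B)) :
    v ∈ col A ∨ ¬ ∃ s a, A *ᵥ a = 0 ∧ B *ᵥ s + a = u ∧ -(A *ᵥ s) = v := by
  by_cases hv : v ∈ col A
  · exact Or.inl hv
  · refine Or.inr ?_
    rintro ⟨s, a, -, -, hv'⟩
    exact hv ⟨-s, by rw [Matrix.mulVecLin_apply, mulVec_neg, hv']⟩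

/-- **Dichotomy, converse for `Q₁`.** A non-trivial codeword of `Q₁` is a non-trivial codeword of `Q` (same
stabilizers). [cite: LinPryadko2024, App. A.6 "a non-trivial Z-codeword in Q₁ or Q₂ is also a non-trivial codeword in Q" (arXiv:2306.16400 chunk p0017 L7–9)] -/
theorem nontrivial_of_Q1 {A B : Matrix ι ι F} {u v : ι → F} (h : A *ᵥ u + B *ᵥ v = 0)
    (hnt : Sum.elim u v ∉ rowSpace (HZ A B)) :
    Sum.elim u v ∈ pcCode (HX A B) ∧ Sum.elim u v ∉ rowSpace (HZ A B) :=
  ⟨(mem_pcCode_HX_iff A B u v).2 h, hnt⟩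

/-- **Dichotomy, converse for `Q₂`.** A codeword of `Q` that is non-trivial in `Q₂` (not of the form
`(Bs + a; −As)`, `Aa = 0`) is non-trivial in `Q` (take `a = 0`).
[cite: LinPryadko2024, App. A.6 (arXiv:2306.16400 chunk p0017 L7–9)] -/
theorem nontrivial_of_Q2 {A B : Matrix ι ι F} {u v : ι → F} (h : A *ᵥ u + B *ᵥ v = 0)
    (hnt : ¬ ∃ s a, A *ᵥ a = 0 ∧ B *ᵥ s + a = u ∧ -(A *ᵥ s) = v) :
    Sum.elim u v ∈ pcCode (HX A B) ∧ Sum.elim u v ∉ rowSpace (HZ A B) := by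
  refine ⟨(mem_pcCode_HX_iff A B u v).2 h, fun htriv => hnt ?_⟩
  obtain ⟨s, hs, hs'⟩ := (mem_rowSpace_HZ_iff A B u v).1 htriv
  exact ⟨s, 0, mulVec_zero _, by rw [hs, add_zero], hs'⟩

/-- The `Z`-codewords of `Q₁` are exactly the trivial codewords of `Q₂`: `Au + Bv = 0 ∧ v ∈ col A` iff
`(u;v) = (Bs + a; −As)` with `Aa = 0` ("the set of non-trivial Z-codewords … is split without an
intersection"). [cite: LinPryadko2024, App. A.6 "v = As … which, in turn, gives u = Bs + (I−F_A)w, a trivial codeword in Q₂" (arXiv:2306.16400 chunk p0017 L15–20)] -/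
theorem Q1_iff_trivial_Q2 {A B : Matrix ι ι F} (hAB : A * B = B * A) (u v : ι → F) :
    (A *ᵥ u + B *ᵥ v = 0 ∧ v ∈ col A) ↔ ∃ s a, A *ᵥ a = 0 ∧ B *ᵥ s + a = u ∧ -(A *ᵥ s) = v := by
  constructor
  · rintro ⟨h, ⟨s', hs'⟩⟩
    rw [Matrix.mulVecLin_apply] at hs'
    refine ⟨-s', u + B *ᵥ s', ?_, by rw [mulVec_neg]; abel, by rw [mulVec_neg, neg_neg, hs']⟩
    rw [mulVec_add, mulVec_mulVec, hAB, ← mulVec_mulVec, hs', h]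
  · rintro ⟨s, a, ha, rfl, rfl⟩
    refine ⟨?_, ⟨-s, by rw [Matrix.mulVecLin_apply, mulVec_neg]⟩⟩
    rw [mulVec_add, ha, add_zero, mulVec_neg, mulVec_mulVec, mulVec_mulVec, hAB, add_neg_cancel]

variable [DecidableEq ι]

/-- The row space of the printed `H_Z^{(L)} = [[B, I−F_A],[−A, 0]]ᵀ` is, for every admissible `F_A`, the
intrinsic subspace `rs H_Z + (ker A ⊕ 0)`: its rows are the `Z`-stabilizers `(Bs; −As)` together with
`(w; 0)`, `w ∈ col(I − F_A) = ker A`.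
[cite: LinPryadko2024, eq. (26) `H_Z^{(L)}` (tex label eq:mat-HZi; arXiv:2306.16400 chunk p0007 L155–160) and App. A.6 "u = Bs + (I−F_A)w, a trivial codeword in Q₂" (chunk p0017 L18–20)] -/
theorem trivial_Q2_printed_iff {P A : Matrix ι ι F} (hP : IsRightIdem P A) (B : Matrix ι ι F) (u v : ι → F) :
    (∃ s w, B *ᵥ s + (1 - P) *ᵥ w = u ∧ -(A *ᵥ s) = v) ↔
      ∃ s a, A *ᵥ a = 0 ∧ B *ᵥ s + a = u ∧ -(A *ᵥ s) = v := by
  constructor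
  · rintro ⟨s, w, hu, hv⟩
    refine ⟨s, (1 - P) *ᵥ w, ?_, hu, hv⟩
    have : (1 - P) *ᵥ w ∈ col (1 - P) := ⟨w, rfl⟩
    rw [hP.col_one_sub] at this
    exact this
  · rintro ⟨s, a, ha, hu, hv⟩
    have : a ∈ col (1 - P) := by rw [hP.col_one_sub]; exact ha
    obtain ⟨w, hw⟩ := this
    exact ⟨s, w, by rw [Matrix.mulVecLin_apply] at hw; rw [hw, hu], hv⟩

end DZIdentity

/-! ### §III.C: the intrinsic meaning of `δ_Z = 0` and `δ_X = 0` -/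

section Defects

/-- `dim(ker A ∩ ker B) = k_S + δ_Z` (the printed "`k₁ = k_S + δ_Z`" count of independent single-block
`Z`-codewords; from `rank H_Z + dim(ker A ∩ ker B) = ℓ = rank H_Z + k_S + δ_Z`).
[cite: LinPryadko2024, App. A.6 "the two codes have dimensions k₁ = k_S + δ_Z and k₂ = k_S + δ_X" (arXiv:2306.16400 chunk p0017 L10–13)] -/
theorem finrank_ker_inf_ker_eq {A B : Matrix ι ι F} (hAB : A * B = B * A) :
    finrank F ↥(LinearMap.ker A.mulVecLin ⊓ LinearMap.ker B.mulVecLin) = kS A B + defectZ A B := by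
  have h1 := rank_HZ_add_finrank_ker_inf A B
  have h2 := rank_HZ_add_kS_add_defectZ hAB
  omega

/-- `ker A + ker B ≤ ker(AB)` for commuting `A, B`. [cite: LinPryadko2024, §III.C (arXiv:2306.16400 chunk p0007 L98–120)] -/
theorem ker_sup_ker_le_ker_mul {A B : Matrix ι ι F} (hAB : A * B = B * A) :
    LinearMap.ker A.mulVecLin ⊔ LinearMap.ker B.mulVecLin ≤ LinearMap.ker (A * B).mulVecLin := by
  refine sup_le ?_ ?_
  · intro v hv
    rw [LinearMap.mem_ker, Matrix.mulVecLin_apply] at hv ⊢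
    rw [hAB, ← mulVec_mulVec, hv, mulVec_zero]
  · intro v hv
    rw [LinearMap.mem_ker, Matrix.mulVecLin_apply] at hv ⊢
    rw [← mulVec_mulVec, hv, mulVec_zero]

/-- `dim(ker A + ker B) + δ_Z = dim ker(AB)`. [cite: LinPryadko2024, §III.A–C (tex labels eq:rank-defect, eq:subsystem-AB; arXiv:2306.16400 chunks p0006 L16–26, L84–89)] -/
theorem finrank_ker_sup_ker_add_defectZ {A B : Matrix ι ι F} (hAB : A * B = B * A) :
    finrank F ↥(LinearMap.ker A.mulVecLin ⊔ LinearMap.ker B.mulVecLin) + defectZ A B =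
      finrank F ↥(LinearMap.ker (A * B).mulVecLin) := by
  have h1 := Submodule.finrank_sup_add_finrank_inf_eq (LinearMap.ker A.mulVecLin) (LinearMap.ker B.mulVecLin)
  have h2 := finrank_ker_inf_ker_eq hAB
  have hA := LinearMap.finrank_range_add_finrank_ker A.mulVecLin
  have hB := LinearMap.finrank_range_add_finrank_ker B.mulVecLin
  have hAB' := LinearMap.finrank_range_add_finrank_ker (A * B).mulVecLin
  have h3 := kS_add A B
  rw [finrank_fintype_fun_eq_card] at hA hB hAB'
  change A.rank + _ = _ at hA
  change B.rank + _ = _ at hB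
  change (A * B).rank + _ = _ at hAB'
  omega

/-- **`δ_Z = 0 ⟺ ker(AB) = ker A + ker B`** — the choice-free content of the vanishing of the `Z` rank
defect. [cite: LinPryadko2024, §III.C Statement 5 hypothesis "Suppose both rank defects in Eq. (rank-defect) are zero" (arXiv:2306.16400 chunk p0007 L121–124), made intrinsic] -/
theorem defectZ_eq_zero_iff {A B : Matrix ι ι F} (hAB : A * B = B * A) :
    defectZ A B = 0 ↔
      LinearMap.ker (A * B).mulVecLin = LinearMap.ker A.mulVecLin ⊔ LinearMap.ker B.mulVecLin := by
  have h := finrank_ker_sup_ker_add_defectZ hAB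
  constructor
  · intro h0
    rw [h0, add_zero] at h
    exact (Submodule.eq_of_le_of_finrank_eq (ker_sup_ker_le_ker_mul hAB) h).symm
  · intro heq
    rw [heq] at h
    omega

/-- **`δ_X = 0 ⟺ col(AB) = col A ∩ col B`.** [cite: LinPryadko2024, §III.A "rank E_A B ≥ rank E_A B A = rank AB = p⋆" with Statement 5's hypothesis (arXiv:2306.16400 chunks p0006 L81, p0007 L121–124), made intrinsic] -/
theorem defectX_eq_zero_iff {A B : Matrix ι ι F} (hAB : A * B = B * A) :
    defectX A B = 0 ↔ col (A * B) = col A ⊓ col B := by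
  have h := defectX_add hAB
  constructor
  · intro h0
    rw [h0, zero_add] at h
    exact Submodule.eq_of_le_of_finrank_eq (col_mul_le_inf hAB) h
  · intro heq
    rw [← heq] at h
    change defectX A B + (A * B).rank = (A * B).rank at h
    omega

/-- `δ_Z(A,B) = δ_X(Bᵀ,Aᵀ)`-type transposition: `δ_X = 0` for `(A, B)` iff `ker(BᵀAᵀ) = ker Bᵀ + ker Aᵀ`
(the `X`-sector form of `defectZ_eq_zero_iff`). [cite: LinPryadko2024, App. A.5 "CSS symmetry combined with the block permutation symmetry gives the other bound" (arXiv:2306.16400 chunk p0016 L90–93)] -/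
theorem defectX_eq_zero_iff_ker {A B : Matrix ι ι F} (hAB : A * B = B * A) :
    defectX A B = 0 ↔
      LinearMap.ker (Bᵀ * Aᵀ).mulVecLin = LinearMap.ker Bᵀ.mulVecLin ⊔ LinearMap.ker Aᵀ.mulVecLin := by
  have hT : Bᵀ * Aᵀ = Aᵀ * Bᵀ := by rw [← transpose_mul, ← transpose_mul, hAB]
  rw [← defectZ_eq_zero_iff hT]
  unfold defectX defectZ
  rw [transpose_transpose, transpose_transpose, inf_comm, ← transpose_mul, rank_transpose]

end Defects

/-! ### Statement 5: the block restriction of a non-trivial codeword is a non-trivial erasure-code logical -/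

section StatementFive

/-- **Statement 5, `Z`-sector core.** If `δ_Z = 0` then every non-trivial `Z`-codeword `(u;v)` of `Q` has a
block which is a non-trivial `Z`-codeword of the corresponding `Z`-punctured code (24):
`u ∈ A⁻¹(col B) ∖ col B` or `v ∈ B⁻¹(col A) ∖ col A`. (Contrapositive: `u = Bs₁`, `v = As₂` give
`AB(s₁+s₂) = 0`, so `s₁ + s₂ ∈ ker A + ker B`, and then `(u;v) = (Bs; −As)` for `s = s₁ − b`.)
[cite: LinPryadko2024, Statement 5 and App. A.5 proof "any non-trivial Z-codeword in one of the Z-punctured codes can be padded with zeros … and independent from the codewords coming from the other punctured code" (arXiv:2306.16400 chunks p0007 L121–129, p0016 L90–112)] -/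
theorem statement5_Z {A B : Matrix ι ι F} (hAB : A * B = B * A) (hZ : defectZ A B = 0) {u v : ι → F}
    (h : A *ᵥ u + B *ᵥ v = 0) (hnt : Sum.elim u v ∉ rowSpace (HZ A B)) :
    (A *ᵥ u ∈ col B ∧ u ∉ col B) ∨ (B *ᵥ v ∈ col A ∧ v ∉ col A) := by
  have hAu : A *ᵥ u ∈ col B :=
    ⟨-v, by rw [Matrix.mulVecLin_apply, mulVec_neg, neg_eq_iff_add_eq_zero, add_comm, h]⟩
  have hBv : B *ᵥ v ∈ col A := ⟨-u, by rw [Matrix.mulVecLin_apply, mulVec_neg, neg_eq_iff_add_eq_zero, h]⟩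
  by_contra hcon
  push Not at hcon
  obtain ⟨h1, h2⟩ := hcon
  obtain ⟨s₁, hs₁⟩ := h1 hAu
  obtain ⟨s₂, hs₂⟩ := h2 hBv
  rw [Matrix.mulVecLin_apply] at hs₁ hs₂
  have hsum : s₁ + s₂ ∈ LinearMap.ker (A * B).mulVecLin := by
    rw [LinearMap.mem_ker, Matrix.mulVecLin_apply, mulVec_add, ← mulVec_mulVec, hs₁]
    nth_rw 1 [hAB]
    rw [← mulVec_mulVec, hs₂, h]
  rw [(defectZ_eq_zero_iff hAB).1 hZ, Submodule.mem_sup] at hsum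
  obtain ⟨a, ha, b, hb, hab⟩ := hsum
  rw [LinearMap.mem_ker, Matrix.mulVecLin_apply] at ha hb
  apply hnt
  rw [mem_rowSpace_HZ_iff]
  refine ⟨s₁ - b, by rw [mulVec_sub, hb, sub_zero, hs₁], ?_⟩
  have : s₁ - b = a - s₂ := sub_eq_sub_iff_add_eq_add.2 hab.symm
  rw [this, mulVec_sub, ha, zero_sub, neg_neg, hs₂]

/-- **Statement 5, `X`-sector core.** If `δ_X = 0` then every non-trivial `X`-codeword `(u;v)` of `Q`
(`Bᵀu = Aᵀv`, not of the form `(Aᵀt; Bᵀt)`) has `u ∈ (Bᵀ)⁻¹(col Aᵀ) ∖ col Aᵀ` or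
`v ∈ (Aᵀ)⁻¹(col Bᵀ) ∖ col Bᵀ` ("CSS symmetry combined with the block permutation symmetry gives the
other bound"). [cite: LinPryadko2024, App. A.5 (arXiv:2306.16400 chunk p0016 L90–93)] -/
theorem statement5_X {A B : Matrix ι ι F} (hAB : A * B = B * A) (hX : defectX A B = 0) {u v : ι → F}
    (h : Bᵀ *ᵥ u = Aᵀ *ᵥ v) (hnt : Sum.elim u v ∉ rowSpace (HX A B)) :
    (Bᵀ *ᵥ u ∈ col Aᵀ ∧ u ∉ col Aᵀ) ∨ (Aᵀ *ᵥ v ∈ col Bᵀ ∧ v ∉ col Bᵀ) := by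
  have hBu : Bᵀ *ᵥ u ∈ col Aᵀ := ⟨v, by rw [Matrix.mulVecLin_apply, h]⟩
  have hAv : Aᵀ *ᵥ v ∈ col Bᵀ := ⟨u, by rw [Matrix.mulVecLin_apply, h]⟩
  by_contra hcon
  push Not at hcon
  obtain ⟨h1, h2⟩ := hcon
  obtain ⟨t₁, ht₁⟩ := h1 hBu
  obtain ⟨t₂, ht₂⟩ := h2 hAv
  rw [Matrix.mulVecLin_apply] at ht₁ ht₂
  have hT : Aᵀ * Bᵀ = Bᵀ * Aᵀ := by rw [← transpose_mul, ← transpose_mul, hAB]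
  have hdiff : t₁ - t₂ ∈ LinearMap.ker (Bᵀ * Aᵀ).mulVecLin := by
    rw [LinearMap.mem_ker, Matrix.mulVecLin_apply, mulVec_sub, ← mulVec_mulVec, ht₁, ← hT,
      ← mulVec_mulVec, ht₂, h, sub_self]
  rw [(defectX_eq_zero_iff_ker hAB).1 hX, Submodule.mem_sup] at hdiff
  obtain ⟨b, hb, a, ha, hab⟩ := hdiff
  rw [LinearMap.mem_ker, Matrix.mulVecLin_apply] at ha hb
  apply hnt
  rw [mem_rowSpace_HX_iff]
  have ht : t₁ - a = t₂ + b := by rw [sub_eq_iff_eq_add, add_assoc, hab, add_sub_cancel]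
  refine ⟨t₁ - a, ?_, ?_⟩
  · rw [mulVec_sub, ha, sub_zero, ht₁]
  · rw [ht, mulVec_add, hb, add_zero, ht₂]

/-- With `δ_X = 0` the `Z`-punctured code's codeword space is `A⁻¹(col B) = ker A + col B` — the dressed
`Z`-logical space `C_{H_X}^⊥` of the erasure subsystem code `css(A, Bᵀ)` (see `dualCode_xStab_erasure`); in
general only `⊇` holds. Stated for a commuting pair `(M, N)` with `δ_X(M,N) = 0`.
[cite: LinPryadko2024, §III.C "In the special case δ_X = 0, this is the same as for single-block erasure subsystem codes (13), and the Z-distances are also the same" (arXiv:2306.16400 chunk p0007 L104–109)] -/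
theorem comap_col_eq_ker_sup_col {M N : Matrix ι ι F} (hMN : M * N = N * M) (hX : defectX M N = 0) :
    (col N).comap M.mulVecLin = LinearMap.ker M.mulVecLin ⊔ col N := by
  apply le_antisymm
  · intro u hu
    rw [Submodule.mem_comap, Matrix.mulVecLin_apply] at hu
    have hu2 : M *ᵥ u ∈ col (M * N) := by
      rw [(defectX_eq_zero_iff hMN).1 hX]
      exact ⟨⟨u, rfl⟩, hu⟩
    obtain ⟨t, ht⟩ := hu2
    rw [Matrix.mulVecLin_apply, ← mulVec_mulVec] at ht
    rw [show u = (u - N *ᵥ t) + N *ᵥ t by abel]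
    refine Submodule.add_mem_sup ?_ ⟨t, rfl⟩
    rw [LinearMap.mem_ker, Matrix.mulVecLin_apply, mulVec_sub, ht, sub_self]
  · refine sup_le ?_ ?_
    · intro u hu
      rw [LinearMap.mem_ker, Matrix.mulVecLin_apply] at hu
      rw [Submodule.mem_comap, Matrix.mulVecLin_apply, hu]
      exact Submodule.zero_mem _
    · rintro _ ⟨t, rfl⟩
      rw [Submodule.mem_comap, Matrix.mulVecLin_apply, Matrix.mulVecLin_apply, mulVec_mulVec, hMN,
        ← mulVec_mulVec]
      exact ⟨M *ᵥ t, rfl⟩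

/-- In general (no defect hypothesis) `ker A + col B ≤ A⁻¹(col B)`: every dressed `Z`-logical of the erasure
code is a `Z`-codeword of the `Z`-punctured code (24). [cite: LinPryadko2024, §III.C eq. (24) (arXiv:2306.16400 chunk p0007 L98–109)] -/
theorem ker_sup_col_le_comap {M N : Matrix ι ι F} (hMN : M * N = N * M) :
    LinearMap.ker M.mulVecLin ⊔ col N ≤ (col N).comap M.mulVecLin := by
  refine sup_le ?_ ?_
  · intro u hu
    rw [LinearMap.mem_ker, Matrix.mulVecLin_apply] at hu
    rw [Submodule.mem_comap, Matrix.mulVecLin_apply, hu]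
    exact Submodule.zero_mem _
  · rintro _ ⟨t, rfl⟩
    rw [Submodule.mem_comap, Matrix.mulVecLin_apply, Matrix.mulVecLin_apply, mulVec_mulVec, hMN,
      ← mulVec_mulVec]
    exact ⟨M *ᵥ t, rfl⟩

/-- `δ_X(Bᵀ, Aᵀ) = δ_Z(A, B)` (transposition exchanges the two defects and the two blocks).
[cite: LinPryadko2024, App. A.1 "or by a transposition" and App. A.5 "CSS symmetry combined with the block permutation symmetry" (arXiv:2306.16400 chunks p0016 L5–7, L90–93)] -/
theorem defectX_transpose_swap (A B : Matrix ι ι F) : defectX Bᵀ Aᵀ = defectZ A B := by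
  unfold defectX defectZ
  rw [inf_comm, ← transpose_mul, rank_transpose]

/-- `rs Bᵀ = col B`: the `Z`-gauge generators `G_Z = Bᵀ` of the erasure code `css(A, Bᵀ)` span `col B`.
[cite: LinPryadko2024, §III "the subsystem block-erasure code css(A,Bᵀ)" (tex label eq:subsystem-AB; arXiv:2306.16400 chunk p0006 L17–26)] -/
theorem rowSpace_transpose (B : Matrix ι ι F) : rowSpace Bᵀ = col B := by
  ext v
  rw [mem_rowSpace_iff]
  constructor
  · rintro ⟨y, rfl⟩
    exact ⟨y, by rw [Matrix.mulVecLin_apply, vecMul_transpose]⟩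
  · rintro ⟨y, rfl⟩
    exact ⟨y, by rw [Matrix.mulVecLin_apply, vecMul_transpose]⟩

/-- `(S + T)^⊥ = S^⊥ ∩ T^⊥`. [cite: MacWilliamsSloane1977, Ch. 1 §8 eq. (42)] -/
private theorem dualCode_sup' (S T : Submodule F (ι → F)) : dualCode (S ⊔ T) = dualCode S ⊓ dualCode T := by
  refine le_antisymm ?_ ?_
  · intro y hy
    refine ⟨mem_dualCode_iff.2 fun c hc => mem_dualCode_iff.1 hy c (Submodule.mem_sup_left hc),
      mem_dualCode_iff.2 fun c hc => mem_dualCode_iff.1 hy c (Submodule.mem_sup_right hc)⟩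
  · intro y hy
    rw [mem_dualCode_iff]
    intro c hc
    obtain ⟨a, ha, b, hb, rfl⟩ := Submodule.mem_sup.1 hc
    rw [add_dotProduct, mem_dualCode_iff.1 hy.1 a ha, mem_dualCode_iff.1 hy.2 b hb, add_zero]

/-- `(S ∩ T)^⊥ = S^⊥ + T^⊥` (finite dimension). [cite: MacWilliamsSloane1977, Ch. 1 §8 Problem (33)(a)] -/
private theorem dualCode_inf' (S T : Submodule F (ι → F)) : dualCode (S ⊓ T) = dualCode S ⊔ dualCode T := by
  rw [← dualCode_inj (C := dualCode (S ⊓ T)), dualCode_dualCode, dualCode_sup', dualCode_dualCode,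
    dualCode_dualCode]

/-- **The dressed `Z`-operator space of the erasure subsystem code `css(A, Bᵀ)` is `ker A + col B`.** Its gauge
group has `G_X = A` (`C_{G_X} = rs A`) and `G_Z = Bᵀ` (`C_{G_Z} = rs Bᵀ = col B`) — the stabilizer group of
`Q` punctured to the left block (eq. (9)); its `X`-STABILIZERS are the gauge `X`-elements commuting with all
`Z`-gauge elements, `C_{H_X} = rs A ∩ (col B)^⊥`; and `C_{H_X}^⊥ = (rs A)^⊥ + col B = ker A + col B`. So the
FIRST expression of eq. (8), `d_Z = min{wgt c : c ∈ C_{H_X}^⊥ ∖ C_{G_Z}}`, is the minimum weight over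
`(ker A + col B) ∖ col B` used in `LinPryadko2024_statement5`.
[cite: LinPryadko2024, §II.B eqs. (8)–(9) "d_Z = min_{c ∈ C_{H_X}^⊥ ∖ C_{G_Z}} wgt c", "a subsystem erasure code has the punctured stabilizer group S_p(I)" (tex labels eq:subsystem-d; arXiv:2306.16400 chunk p0005 L100–114)] -/
theorem dualCode_xStab_erasure (A B : Matrix ι ι F) :
    dualCode (rowSpace A ⊓ dualCode (col B)) = LinearMap.ker A.mulVecLin ⊔ col B := by
  rw [dualCode_inf', dualCode_dualCode, dualCode_rowSpace]
  rfl

variable [DecidableEq F]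

omit [Fintype ι] in
/-- Every vector on `ι ⊕ ι` is the pair of its two blocks. [folklore] -/
private theorem sumElim_comp_eq {α : Type*} (c : ι ⊕ ι → α) : Sum.elim (c ∘ Sum.inl) (c ∘ Sum.inr) = c := by
  funext x; rcases x with i | i <;> rfl

/-- **Lin–Pryadko 2024, Statement 5 — corrected form, PROVED.** Let `A, B` commute with both intrinsic rank
defects zero, `δ_X = δ_Z = 0`. If `D` is a common lower bound for the DRESSED sector distances of BOTH
single-block erasure subsystem codes — `css(A,Bᵀ)`: `Z`-logicals `(ker A + col B) ∖ col B`, `X`-logicals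
`(ker Bᵀ + rs A) ∖ rs A`; and `css(B,Aᵀ)` (the left-block erasure): `Z`-logicals `(ker B + col A) ∖ col A`,
`X`-logicals `(ker Aᵀ + rs B) ∖ rs B` — then `D ≤ d(Q)`, the Tillich–Zémor minimum distance of the two-block
code. (As printed: "`d ≥ d_S`, `d_S ≡ d(A,Bᵀ)`" with `d_S` "the common parameters" of the two erasure codes;
they are NOT common in general — `statement5_asPrinted_counterexample` — and the minimum over both is what the
printed proof establishes.) Here `rs A = col Aᵀ`, `rs B = col Bᵀ`.
[cite: LinPryadko2024, Statement 5 "Suppose both rank defects in Eq. (rank-defect) are zero, δ_X = δ_Z = 0. Then, d ≥ d_S, d_S ≡ d(A,Bᵀ)" (arXiv:2306.16400 chunk p0007 L121–129); proof App. A.5 (chunk p0016 L70–112)] -/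
theorem LinPryadko2024_statement5 {A B : Matrix ι ι F} (hAB : A * B = B * A) (hX : defectX A B = 0)
    (hZ : defectZ A B = 0) {D : ℕ}
    (hZL : ∀ u, u ∈ LinearMap.ker A.mulVecLin ⊔ col B → u ∉ col B → D ≤ hammingNorm u)
    (hZR : ∀ v, v ∈ LinearMap.ker B.mulVecLin ⊔ col A → v ∉ col A → D ≤ hammingNorm v)
    (hXL : ∀ u, u ∈ LinearMap.ker Bᵀ.mulVecLin ⊔ col Aᵀ → u ∉ col Aᵀ → D ≤ hammingNorm u)
    (hXR : ∀ v, v ∈ LinearMap.ker Aᵀ.mulVecLin ⊔ col Bᵀ → v ∉ col Bᵀ → D ≤ hammingNorm v) :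
    (D : ℕ∞) ≤ cssMinDist (HX A B) (HZ A B) := by
  have hBA : B * A = A * B := hAB.symm
  have hT : Bᵀ * Aᵀ = Aᵀ * Bᵀ := by rw [← transpose_mul, ← transpose_mul, hAB]
  have hT' : Aᵀ * Bᵀ = Bᵀ * Aᵀ := hT.symm
  -- `δ_X(B,A) = δ_X(A,B)`, `δ_X(Bᵀ,Aᵀ) = δ_Z(A,B)`, `δ_X(Aᵀ,Bᵀ) = δ_Z(B,A) = δ_Z(A,B)`
  have hXBA : defectX B A = 0 := by
    unfold defectX at hX ⊢
    rwa [inf_comm, hBA]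
  have hXt : defectX Bᵀ Aᵀ = 0 := by rw [defectX_transpose_swap]; exact hZ
  have hXt' : defectX Aᵀ Bᵀ = 0 := by
    rw [defectX_transpose_swap]
    unfold defectZ at hZ ⊢
    rwa [inf_comm, hBA]
  refine le_cssMinDist_iff.2 fun e he => ?_
  rw [← sumElim_comp_eq e] at he
  rw [← sumElim_comp_eq e, hammingNorm_sumElim', Nat.cast_le]
  rcases he with ⟨he, he'⟩ | ⟨he, he'⟩
  · -- a non-trivial `Z`-codeword
    rw [mem_pcCode_HX_iff] at he
    rcases statement5_Z hAB hZ he he' with ⟨h1, h2⟩ | ⟨h1, h2⟩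
    · have hu : e ∘ Sum.inl ∈ LinearMap.ker A.mulVecLin ⊔ col B := by
        rw [← comap_col_eq_ker_sup_col hAB hX]; exact h1
      exact (hZL _ hu h2).trans (Nat.le_add_right _ _)
    · have hv : e ∘ Sum.inr ∈ LinearMap.ker B.mulVecLin ⊔ col A := by
        rw [← comap_col_eq_ker_sup_col hBA hXBA]; exact h1
      exact (hZR _ hv h2).trans (Nat.le_add_left _ _)
  · -- a non-trivial `X`-codeword
    rw [mem_pcCode_HZ_iff] at he
    rcases statement5_X hAB hX he he' with ⟨h1, h2⟩ | ⟨h1, h2⟩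
    · have hu : e ∘ Sum.inl ∈ LinearMap.ker Bᵀ.mulVecLin ⊔ col Aᵀ := by
        rw [← comap_col_eq_ker_sup_col hT hXt]; exact h1
      exact (hXL _ hu h2).trans (Nat.le_add_right _ _)
    · have hv : e ∘ Sum.inr ∈ LinearMap.ker Aᵀ.mulVecLin ⊔ col Bᵀ := by
        rw [← comap_col_eq_ker_sup_col hT' hXt']; exact h1
      exact (hXR _ hv h2).trans (Nat.le_add_left _ _)

/-- Without the identification step: if only `δ_Z = 0`, a common lower bound `D` of the `Z`-distances of the
two `Z`-punctured codes (24) — codewords `A⁻¹(col B)`, resp. `B⁻¹(col A)`, trivial spaces `col B`, resp.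
`col A` — bounds every non-trivial `Z`-codeword of `Q` below (the `Z`-puncturing bound as used in App. A.5).
[cite: LinPryadko2024, App. A.5 Lemma 14 (Z-puncturing bound of Zeng–Pryadko) and its application (arXiv:2306.16400 chunk p0016 L75–112)] -/
theorem le_hammingNorm_of_zPunctured {A B : Matrix ι ι F} (hAB : A * B = B * A) (hZ : defectZ A B = 0)
    {D : ℕ} (hL : ∀ u, A *ᵥ u ∈ col B → u ∉ col B → D ≤ hammingNorm u)
    (hR : ∀ v, B *ᵥ v ∈ col A → v ∉ col A → D ≤ hammingNorm v) {u v : ι → F}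
    (h : A *ᵥ u + B *ᵥ v = 0) (hnt : Sum.elim u v ∉ rowSpace (HZ A B)) :
    D ≤ hammingNorm (Sum.elim u v) := by
  rw [hammingNorm_sumElim']
  rcases statement5_Z hAB hZ h hnt with ⟨h1, h2⟩ | ⟨h1, h2⟩
  · exact (hL u h1 h2).trans (Nat.le_add_right _ _)
  · exact (hR v h1 h2).trans (Nat.le_add_left _ _)

end StatementFive

/-! ### Certificates: non-membership witnesses and a trivial-intersection certificate (any field) -/

section Certificates

/-- `u ∉ col N` from a witness `y` with `Nᵀ y = 0`, `y · u ≠ 0` (`(col N)^⊥ = ker Nᵀ`).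
[cite: MacWilliamsSloane1977, Ch. 1 §8 ("C⊥ has generator matrix = H")] -/
theorem not_mem_col_of_witness {N : Matrix ι ι F} {u : ι → F} (y : ι → F) (h1 : Nᵀ *ᵥ y = 0)
    (h2 : y ⬝ᵥ u ≠ 0) : u ∉ col N := by
  rintro ⟨s, rfl⟩
  apply h2
  rw [Matrix.mulVecLin_apply, dotProduct_mulVec, ← mulVec_transpose, h1, zero_dotProduct]

/-- `u ∉ ker M + col N` from a witness `y = Mᵀ t ∈ rs M` with `Nᵀ y = 0` and `y · u ≠ 0`
(`(ker M + col N)^⊥ = rs M ∩ ker Nᵀ`). [cite: MacWilliamsSloane1977, Ch. 1 §8 Problem (33)(a)] -/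
theorem not_mem_ker_sup_col_of_witness {M N : Matrix ι ι F} {u : ι → F} (t : ι → F)
    (h1 : Nᵀ *ᵥ (Mᵀ *ᵥ t) = 0) (h2 : (Mᵀ *ᵥ t) ⬝ᵥ u ≠ 0) :
    u ∉ LinearMap.ker M.mulVecLin ⊔ col N := by
  intro h
  obtain ⟨a, ha, _, ⟨s, rfl⟩, rfl⟩ := Submodule.mem_sup.1 h
  rw [LinearMap.mem_ker, Matrix.mulVecLin_apply] at ha
  apply h2
  rw [Matrix.mulVecLin_apply, dotProduct_add, dotProduct_mulVec (Mᵀ *ᵥ t) N s, ← mulVec_transpose N, h1,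
    zero_dotProduct, add_zero, mulVec_transpose, ← dotProduct_mulVec, ha, dotProduct_zero]

/-- **`col A ∩ col B = 0` by certificate**: decompositions `eᵢ = aᵢ + bᵢ` with `Aᵀaᵢ = 0`, `Bᵀbᵢ = 0`
(i.e. `ker Aᵀ + ker Bᵀ = F^ℓ`, the dual statement). [cite: MacWilliamsSloane1977, Ch. 1 §8 Problem (33)(a)] -/
theorem col_inf_col_eq_bot_of_certificate [DecidableEq ι] {A B : Matrix ι ι F} (a b : ι → ι → F)
    (ha : ∀ i, Aᵀ *ᵥ a i = 0) (hb : ∀ i, Bᵀ *ᵥ b i = 0) (he : ∀ i, a i + b i = Pi.single i 1) :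
    col A ⊓ col B = ⊥ := by
  rw [Submodule.eq_bot_iff]
  rintro x ⟨⟨s, rfl⟩, ⟨t, ht⟩⟩
  simp only [Matrix.mulVecLin_apply] at ht ⊢
  funext i
  have h1 : (A *ᵥ s) ⬝ᵥ Pi.single i 1 = (A *ᵥ s) i := by rw [dotProduct_single, mul_one]
  rw [Pi.zero_apply, ← h1, ← he i, dotProduct_add]
  nth_rw 2 [← ht]
  rw [dotProduct_comm (A *ᵥ s), dotProduct_mulVec, ← mulVec_transpose, ha, zero_dotProduct,
    dotProduct_comm (B *ᵥ t), dotProduct_mulVec, ← mulVec_transpose, hb, zero_dotProduct, add_zero]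

end Certificates

/-! ### Kernel counterexamples over `𝔽₂` -/

section Counterexamples

/-- A vector of weight `≤ 1` over `𝔽₂` is `0` or some `eᵢ`. [folklore] -/
private theorem eq_zero_or_single_of_hammingNorm_le_one {κ : Type*} [Fintype κ] [DecidableEq κ]
    (w : κ → ZMod 2) (hw : hammingNorm w ≤ 1) : w = 0 ∨ ∃ q, w = Pi.single q 1 := by
  by_cases h0 : w = 0
  · exact Or.inl h0
  right
  obtain ⟨q, hq⟩ : ∃ q, w q ≠ 0 := by
    by_contra h
    exact h0 (funext fun i => by_contra fun hne => h ⟨i, hne⟩)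
  have h01 : ∀ z : ZMod 2, z = 0 ∨ z = 1 := by decide
  refine ⟨q, funext fun i => ?_⟩
  by_cases hi : i = q
  · subst hi
    rcases h01 (w i) with h | h
    · exact absurd h hq
    · simp [h]
  · rw [Pi.single_eq_of_ne hi]
    by_contra hne
    have h2 : 2 ≤ hammingNorm w := by
      unfold hammingNorm
      calc 2 = ({q, i} : Finset κ).card := by rw [Finset.card_pair (Ne.symm hi)]
        _ ≤ _ := Finset.card_le_card (by
          intro j hj
          simp only [Finset.mem_insert, Finset.mem_singleton] at hj
          rcases hj with rfl | rfl <;> simpa)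
    omega

/-- Weight `≥ 2` on a difference `S ∖ T` of subspaces (`0 ∈ T`) from "no `eᵢ` lies in `S ∖ T`". [folklore] -/
private theorem two_le_hammingNorm_of_singles {κ : Type*} [Fintype κ] [DecidableEq κ]
    {S T : Submodule (ZMod 2) (κ → ZMod 2)} (h : ∀ q, Pi.single q 1 ∉ S ∨ Pi.single q 1 ∈ T)
    {u : κ → ZMod 2} (hu : u ∈ S) (hu' : u ∉ T) : 2 ≤ hammingNorm u := by
  by_contra hlt
  rcases eq_zero_or_single_of_hammingNorm_le_one u (by omega) with rfl | ⟨q, rfl⟩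
  · exact hu' (Submodule.zero_mem _)
  · rcases h q with h | h
    · exact h hu
    · exact hu' h

/-- `A` of the Statement-5 counterexample: rows `(1111), (0110), (1001), (1111)` (`ℓ = 4`, `𝔽₂`).
[cite: LinPryadko2024, Statement 5 (arXiv:2306.16400 chunk p0007 L121–129)] -/
def cex5A : Matrix (Fin 4) (Fin 4) (ZMod 2) := !![1, 1, 1, 1; 0, 1, 1, 0; 1, 0, 0, 1; 1, 1, 1, 1]

/-- `B` of the Statement-5 counterexample: all rows `(1110)`. [cite: LinPryadko2024, Statement 5 (arXiv:2306.16400 chunk p0007 L121–129)] -/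
def cex5B : Matrix (Fin 4) (Fin 4) (ZMod 2) := !![1, 1, 1, 0; 1, 1, 1, 0; 1, 1, 1, 0; 1, 1, 1, 0]

/-- `AB = BA = 0`: a commuting pair with `p⋆ = 0`. [cite: LinPryadko2024, §III "p⋆ ≡ rank(AB)" and §III.C "except when p = 0, or, equivalently, AB = 0, in which case the erasure code css(A,Bᵀ) is also a stabilizer code" (arXiv:2306.16400 chunks p0006 L24–26, p0007 L136–139)] -/
theorem cex5_comm : cex5A * cex5B = cex5B * cex5A ∧ cex5A * cex5B = 0 := by
  constructor <;> decide

/-- Both intrinsic rank defects of the counterexample vanish: `col A ∩ col B = 0 = col(AB)` and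
`row A ∩ row B = 0` (certificates `eᵢ = aᵢ + bᵢ`). [cite: LinPryadko2024, Statement 5 hypothesis "δ_X = δ_Z = 0" (arXiv:2306.16400 chunk p0007 L121–124)] -/
theorem cex5_defects : defectX cex5A cex5B = 0 ∧ defectZ cex5A cex5B = 0 := by
  have hcol0 : ∀ M : Matrix (Fin 4) (Fin 4) (ZMod 2), M = 0 → col M = ⊥ := by
    rintro M rfl
    change LinearMap.range (0 : Matrix (Fin 4) (Fin 4) (ZMod 2)).mulVecLin = ⊥
    rw [Matrix.mulVecLin_zero, LinearMap.range_zero]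
  constructor
  · rw [defectX_eq_zero_iff cex5_comm.1, hcol0 _ cex5_comm.2]
    refine (col_inf_col_eq_bot_of_certificate
      ![![1, 1, 1, 0], ![0, 1, 1, 1], ![0, 1, 1, 1], ![1, 1, 1, 0]]
      ![![0, 1, 1, 0], ![0, 0, 1, 1], ![0, 1, 0, 1], ![1, 1, 1, 1]] ?_ ?_ ?_).symm <;> decide
  · rw [← defectX_transpose_swap,
      defectX_eq_zero_iff (by rw [← transpose_mul, ← transpose_mul, cex5_comm.1]),
      hcol0 _ (by rw [← transpose_mul, cex5_comm.2, transpose_zero])]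
    refine (col_inf_col_eq_bot_of_certificate (A := cex5Bᵀ) (B := cex5Aᵀ)
      ![![0, 0, 0, 1], ![1, 0, 1, 1], ![1, 1, 0, 1], ![0, 0, 0, 1]]
      ![![1, 0, 0, 1], ![1, 1, 1, 1], ![1, 1, 1, 1], ![0, 0, 0, 0]] ?_ ?_ ?_).symm <;> decide

/-- The two-block code of the counterexample has the weight-one non-trivial `Z`-codeword `(0; e₃)`
(`Be₃ = 0`; the witness `(e₃; 0) ∈ ker H_Z` has odd overlap), so `d(Q) ≤ 1`.
[cite: LinPryadko2024, Statement 5 conclusion "d ≥ d_S" (arXiv:2306.16400 chunk p0007 L124–129)] -/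
theorem cex5_cssMinDist_le_one : cssMinDist (HX cex5A cex5B) (HZ cex5A cex5B) ≤ 1 := by
  have h1 : Sum.elim (0 : Fin 4 → ZMod 2) (Pi.single 3 1) ∈ pcCode (HX cex5A cex5B) := by
    rw [mem_pcCode_HX_iff]; decide
  have h2 : Sum.elim (0 : Fin 4 → ZMod 2) (Pi.single 3 1) ∉ rowSpace (HZ cex5A cex5B) := by
    rw [not_mem_rowSpace_iff]
    exact ⟨Sum.elim 0 ![1, 0, 0, 1], by decide, by decide⟩
  have h := cssMinDist_le_hammingNorm (HX := HX cex5A cex5B) (HZ := HZ cex5A cex5B) (Or.inl ⟨h1, h2⟩)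
  have hw : hammingNorm (Sum.elim (0 : Fin 4 → ZMod 2) (Pi.single (3 : Fin 4) (1 : ZMod 2))) = 1 := by decide
  rwa [hw, Nat.cast_one] at h

/-- **The right-block erasure code `css(A, Bᵀ)` of the counterexample has distance `2`:** it has the dressed
`Z`-logical `(1001) ∈ (ker A + col B) ∖ col B` of weight `2`, and EVERY dressed logical of either sector has
weight `≥ 2` (no `eᵢ` lies in `ker A + col B = {0, 1001, 0110, 1111}` nor in `ker Bᵀ + rs A =` the even
vectors; witnesses in `rs A ∩ ker Bᵀ`, resp. `col B ∩ ker A`). [cite: LinPryadko2024, eq. (13) "[[ℓ, k_S, d_S]]" with eq. (8) (arXiv:2306.16400 chunks p0006 L17–26, p0005 L100–105)] -/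
theorem cex5_erasure_right :
    (∃ u, u ∈ LinearMap.ker cex5A.mulVecLin ⊔ col cex5B ∧ u ∉ col cex5B ∧ hammingNorm u = 2) ∧
    (∀ u, u ∈ LinearMap.ker cex5A.mulVecLin ⊔ col cex5B → u ∉ col cex5B → 2 ≤ hammingNorm u) ∧
    (∀ u, u ∈ LinearMap.ker cex5Bᵀ.mulVecLin ⊔ col cex5Aᵀ → u ∉ col cex5Aᵀ → 2 ≤ hammingNorm u) := by
  refine ⟨⟨![1, 0, 0, 1], Submodule.mem_sup_left (LinearMap.mem_ker.2 (by decide : cex5A *ᵥ ![1, 0, 0, 1] = 0)),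
    not_mem_col_of_witness ![1, 1, 0, 0]
    (by decide) (by decide), by decide⟩, fun u hu hu' => two_le_hammingNorm_of_singles ?_ hu hu',
    fun u hu hu' => two_le_hammingNorm_of_singles ?_ hu hu'⟩
  · intro q
    left
    -- witness `Aᵀ t ∈ rs A ∩ ker Bᵀ` with `(Aᵀ t)_q = 1`: rows `1001` (t = e₂) for q ∈ {0,3}, `0110` (t = e₁) else
    fin_cases q
    · exact not_mem_ker_sup_col_of_witness (Pi.single 2 1) (by decide) (by decide)
    · exact not_mem_ker_sup_col_of_witness (Pi.single 1 1) (by decide) (by decide)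
    · exact not_mem_ker_sup_col_of_witness (Pi.single 1 1) (by decide) (by decide)
    · exact not_mem_ker_sup_col_of_witness (Pi.single 2 1) (by decide) (by decide)
  · intro q
    left
    -- witness `B t = (1111) ∈ col B ∩ ker A` (t = e₀) for every q
    exact not_mem_ker_sup_col_of_witness (Pi.single 0 1) (by decide) (by fin_cases q <;> decide)

/-- **The left-block erasure code `css(B, Aᵀ)` of the counterexample has distance `1`:** `e₃ ∈ ker B ∖ col A`
is a (bare, hence dressed) `Z`-logical of weight one. So the two erasure codes do NOT have "common parameters
`[[ℓ, k_S, d_S]]`" (eq. (13)): `d(css(A,Bᵀ)) = 2 ≠ 1 = d(css(B,Aᵀ))`.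
[cite: LinPryadko2024, eq. (13) "We will denote the common parameters of these codes as [[ℓ,k_S,d_S]]_q" (arXiv:2306.16400 chunk p0006 L17–26)] -/
theorem cex5_erasure_left :
    cex5B *ᵥ ![0, 0, 0, 1] = 0 ∧ (![0, 0, 0, 1] : Fin 4 → ZMod 2) ∉ col cex5A ∧
      hammingNorm (![0, 0, 0, 1] : Fin 4 → ZMod 2) = 1 :=
  ⟨by decide, not_mem_col_of_witness ![1, 0, 0, 1] (by decide) (by decide), by decide⟩

/-- **Statement 5 as printed is false; eq. (13)'s "common parameters" do not exist in general.** For the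
commuting pair `(A, B) = (cex5A, cex5B)` over `𝔽₂` (`AB = 0`, `δ_X = δ_Z = 0`): the two-block code has
`d ≤ 1` (indeed `= 1`), the right-block erasure code `css(A, Bᵀ)` — whose distance is the printed
`d_S ≡ d(A, Bᵀ)` — has all (dressed) logicals of weight `≥ 2` and one of weight `2`, while the left-block
erasure code `css(B, Aᵀ)` has a weight-`1` logical. Hence `d = 1 < 2 = d(A,Bᵀ)`, contradicting
"`d ≥ d_S`, `d_S ≡ d(A,Bᵀ)`" read literally; the corrected statement `d ≥ min(d(css(A,Bᵀ)), d(css(B,Aᵀ)))`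
(`LinPryadko2024_statement5`) holds (here with equality `1 = min(2,1)`).
[cite: LinPryadko2024, Statement 5 (tex label th:d-lower-puncturing; arXiv:2306.16400 chunk p0007 L121–129) and eq. (13) (chunk p0006 L17–26)] -/
theorem statement5_asPrinted_counterexample :
    cex5A * cex5B = cex5B * cex5A ∧ defectX cex5A cex5B = 0 ∧ defectZ cex5A cex5B = 0 ∧
    cssMinDist (HX cex5A cex5B) (HZ cex5A cex5B) ≤ 1 ∧
    (∀ u, u ∈ LinearMap.ker cex5A.mulVecLin ⊔ col cex5B → u ∉ col cex5B → 2 ≤ hammingNorm u) ∧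
    (∀ u, u ∈ LinearMap.ker cex5Bᵀ.mulVecLin ⊔ col cex5Aᵀ → u ∉ col cex5Aᵀ → 2 ≤ hammingNorm u) ∧
    (∃ u, u ∈ LinearMap.ker cex5A.mulVecLin ⊔ col cex5B ∧ u ∉ col cex5B ∧ hammingNorm u = 2) ∧
    (∃ v, cex5B *ᵥ v = 0 ∧ v ∉ col cex5A ∧ hammingNorm v = 1) :=
  ⟨cex5_comm.1, cex5_defects.1, cex5_defects.2, cex5_cssMinDist_le_one, cex5_erasure_right.2.1,
    cex5_erasure_right.2.2, cex5_erasure_right.1, ⟨_, cex5_erasure_left⟩⟩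

/-- `A = B` of the eq.-(8) example: rows `(00), (11)` (`ℓ = 2`, `𝔽₂`). [cite: LinPryadko2024, §II.B eq. (8) (tex label eq:subsystem-d; arXiv:2306.16400 chunk p0005 L100–105)] -/
def cex8A : Matrix (Fin 2) (Fin 2) (ZMod 2) := !![0, 0; 1, 1]

/-- **The two expressions of eq. (8) differ in general.** For the erasure subsystem code `css(A, Aᵀ)` of the
two-block code on the commuting pair `(A, A)`, `A = cex8A`: the DRESSED `Z`-logical `e₀ = (11) + (01) ∈
C_{H_X}^⊥ ∖ C_{G_Z} = (ker A + col A) ∖ col A` has weight `1`, whereas every BARE `Z`-logical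
`c ∈ C_{G_X}^⊥ ∖ C_{G_Z} = ker A ∖ col A = {(11)}` has weight `2`: `min_{C_{H_X}^⊥ ∖ C_{G_Z}} wgt = 1 ≠ 2 =
min_{C_{G_X}^⊥ ∖ C_{G_Z}} wgt`. [cite: LinPryadko2024, §II.B eq. (8) "d_Z = min_{c ∈ C_{H_X}^⊥ ∖ C_{G_Z}} wgt c = min_{c ∈ C_{G_X}^⊥ ∖ C_{G_Z}} wgt c" (tex label eq:subsystem-d; arXiv:2306.16400 chunk p0005 L100–105)] -/
theorem eq8_dressed_ne_bare :
    (∃ u, u ∈ LinearMap.ker cex8A.mulVecLin ⊔ col cex8A ∧ u ∉ col cex8A ∧ hammingNorm u = 1) ∧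
    (∀ u, cex8A *ᵥ u = 0 → u ∉ col cex8A → 2 ≤ hammingNorm u) := by
  refine ⟨⟨Pi.single 0 1, ?_, not_mem_col_of_witness ![1, 0] (by decide) (by decide), by decide⟩,
    fun u hu hu' => ?_⟩
  · have h : (Pi.single 0 1 : Fin 2 → ZMod 2) = ![1, 1] + cex8A *ᵥ Pi.single 0 1 := by decide
    rw [h]
    exact Submodule.add_mem_sup (LinearMap.mem_ker.2 (by decide : cex8A *ᵥ ![1, 1] = 0)) ⟨Pi.single 0 1, rfl⟩
  · refine two_le_hammingNorm_of_singles (S := LinearMap.ker cex8A.mulVecLin) (T := col cex8A)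
      (fun q => Or.inl ?_) hu hu'
    rw [LinearMap.mem_ker, Matrix.mulVecLin_apply]
    fin_cases q <;> decide

end Counterexamples


/-! ### §III.C eq. (24): the `Z`-punctured codes `css((1−E_B)A, Bᵀ)`, `css((1−E_A)B, Aᵀ)` have dimension `k_S + δ_X`
(appended 2026-08-27, qec-lit-3 g6: the printed dimension count, PROVED for EVERY admissible idempotent — it is
choice-free although `E_B` is not, cf. `TwoBlockCodeDimension.printed_defect_depends_on_choice`) -/

section EqTwentyFour

variable [DecidableEq ι]

/-- Rank of a projected matrix: `rank((1−E_B)A) + dim(col A ∩ col B) = rank A` for every admissible `E_B`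
(`ker(1−E_B) = col B`; rank–nullity for `1−E_B` restricted to `col A`).
[cite: LinPryadko2024, §III.C eq. (24) "both have the dimension k_S + δ_X" (tex label eq:Z-punctured; arXiv:2306.16400 chunk p0007 L98–106)] -/
theorem rank_one_sub_mul_add_finrank_inf {E B : Matrix ι ι F} (hE : IsLeftIdem E B) (A : Matrix ι ι F) :
    ((1 - E) * A).rank + finrank F ↥(col A ⊓ col B) = A.rank := by
  set f := (1 - E).mulVecLin with hf
  have h1 : ((1 - E) * A).rank = finrank F ↥(LinearMap.range (f.domRestrict (col A))) := by
    rw [LinearMap.range_domRestrict, Matrix.rank, Matrix.mulVecLin_mul, LinearMap.range_comp]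
  have h2 : finrank F ↥(col A ⊓ col B) = finrank F ↥(LinearMap.ker (f.domRestrict (col A))) := by
    rw [LinearMap.ker_domRestrict, ← Submodule.finrank_map_subtype_eq, Submodule.map_comap_subtype, hf,
      hE.ker_one_sub]
  rw [h1, h2, LinearMap.finrank_range_add_finrank_ker]
  rfl

/-- **Eq. (24), left code: `dim css((1−E_B)A, Bᵀ) = ℓ − rank((1−E_B)A) − rank Bᵀ = k_S + δ_X`** (additive form),
for every admissible `E_B`. [cite: LinPryadko2024, §III.C eq. (24) "It is easy to see that the Z-punctured stabilizer codes css((1−E_B)A, Bᵀ) and css((1−E_A)B, Aᵀ) both have the dimension k_S + δ_X" (tex label eq:Z-punctured; arXiv:2306.16400 chunk p0007 L98–106)] -/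
theorem eq24_dim_left {A B E : Matrix ι ι F} (hAB : A * B = B * A) (hE : IsLeftIdem E B) :
    ((1 - E) * A).rank + Bᵀ.rank + (kS A B + defectX A B) = Fintype.card ι := by
  have h1 := rank_one_sub_mul_add_finrank_inf hE A
  have h2 := kS_add A B
  have h3 := defectX_add hAB
  rw [Matrix.rank_transpose]
  omega

/-- **Eq. (24), right code: `dim css((1−E_A)B, Aᵀ) = k_S + δ_X`** as well, for every admissible `E_A`.
[cite: LinPryadko2024, §III.C eq. (24) (tex label eq:Z-punctured; arXiv:2306.16400 chunk p0007 L98–106)] -/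
theorem eq24_dim_right {A B E : Matrix ι ι F} (hAB : A * B = B * A) (hE : IsLeftIdem E A) :
    ((1 - E) * B).rank + Aᵀ.rank + (kS A B + defectX A B) = Fintype.card ι := by
  have h1 := rank_one_sub_mul_add_finrank_inf hE B
  have h2 := kS_add A B
  have h3 := defectX_add hAB
  rw [inf_comm] at h1
  rw [Matrix.rank_transpose]
  omega

/-- The `X`-rows and `Z`-rows of the punctured code commute: `((1−E_B)A)·(Bᵀ)ᵀ = (1−E_B)BA = 0`, so
`css((1−E_B)A, Bᵀ)` IS a stabilizer code. [cite: LinPryadko2024, §III.C eq. (24) "the Z-punctured stabilizer codes" (arXiv:2306.16400 chunk p0007 L98–103)] -/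
theorem one_sub_mul_mul_transpose_transpose {A B E : Matrix ι ι F} (hAB : A * B = B * A) (hE : IsLeftIdem E B) :
    ((1 - E) * A) * (Bᵀ)ᵀ = 0 := by
  rw [Matrix.transpose_transpose, Matrix.mul_assoc, hAB, ← Matrix.mul_assoc, Matrix.sub_mul, Matrix.one_mul,
    hE.mul_eq, sub_self, Matrix.zero_mul]

/-- "In the special case `δ_X = 0`, this is the same as for single-block erasure subsystem codes (`k_S`)."
[cite: LinPryadko2024, §III.C after eq. (24) (arXiv:2306.16400 chunk p0007 L106–108)] -/
theorem eq24_dim_left_of_defectX_eq_zero {A B E : Matrix ι ι F} (hAB : A * B = B * A) (hE : IsLeftIdem E B)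
    (hX : defectX A B = 0) : ((1 - E) * A).rank + Bᵀ.rank + kS A B = Fintype.card ι := by
  have := eq24_dim_left hAB hE
  rwa [hX, add_zero] at this

end EqTwentyFour

/-! ### App. A.6: the dimension counts `rank H_Z^{(L)} = ℓ`, `k₂ = k_S + δ_X`, `k₁ + k₂ = k`
(appended 2026-08-27, qec-lit-3 g6). `Q₂ = css(H_X, H_Z^{(L)})` has trivial space `rs H_Z + (ker A ⊕ 0)`
(`trivial_Q2_printed_iff`); here that subspace is `rowSpace (HZ A B) ⊔ (ker A).map leftEmbed`. -/

section AppASix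

omit [Fintype ι] in
/-- The left-block embedding `u ↦ (u; 0)` of `F^ℓ` into `F^{2ℓ}`. (definition, auxiliary)
[cite: LinPryadko2024, §III.B "the pair (u; 0)" (arXiv:2306.16400 chunk p0007 L51–53) and App. A.6 (chunk p0017 L15–20)] -/
def leftEmbed : (ι → F) →ₗ[F] (ι ⊕ ι → F) where
  toFun u := Sum.elim u 0
  map_add' u v := by
    funext i
    cases i <;> simp
  map_smul' c u := by
    funext i
    cases i <;> simp

omit [Fintype ι] in
/-- `leftEmbed u = (u; 0)`. [cite: LinPryadko2024, §III.B (arXiv:2306.16400 chunk p0007 L51–53)] -/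
@[simp] theorem leftEmbed_apply (u : ι → F) : leftEmbed u = Sum.elim u 0 := rfl

omit [Fintype ι] in
/-- `u ↦ (u;0)` is injective. [cite: LinPryadko2024, §III.B (arXiv:2306.16400 chunk p0007 L51–53)] -/
theorem leftEmbed_injective : Function.Injective (leftEmbed : (ι → F) →ₗ[F] (ι ⊕ ι → F)) := by
  intro u v h
  funext i
  simpa using congrFun h (Sum.inl i)

/-- `rs H_Z ∩ (ker A ⊕ 0) = (B(ker A) ⊕ 0)`: a `Z`-stabilizer `(Bs; −As)` lies in the left block iff `As = 0`.
[cite: LinPryadko2024, App. A.6 "the ranks of the extended matrices H_X^{(L)} and H_Z^{(L)} both equal to ℓ" (arXiv:2306.16400 chunk p0017 L9–13)] -/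
theorem rowSpace_HZ_inf_kerLeft_eq {A B : Matrix ι ι F} (hAB : A * B = B * A) :
    rowSpace (HZ A B) ⊓ (LinearMap.ker A.mulVecLin).map leftEmbed =
      (LinearMap.ker A.mulVecLin).map (leftEmbed ∘ₗ B.mulVecLin) := by
  ext x
  constructor
  · rintro ⟨hx, ⟨a, -, rfl⟩⟩
    obtain ⟨s, hs, hs'⟩ := (mem_rowSpace_HZ_iff A B a 0).1 hx
    refine ⟨s, ?_, ?_⟩
    · show A *ᵥ s = 0
      exact neg_eq_zero.mp hs'
    · rw [LinearMap.comp_apply, Matrix.mulVecLin_apply, hs]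
  · rintro ⟨s, hs, rfl⟩
    have hs : A *ᵥ s = 0 := hs
    refine ⟨?_, ⟨B *ᵥ s, ?_, rfl⟩⟩
    · show Sum.elim (B *ᵥ s) 0 ∈ rowSpace (HZ A B)
      rw [mem_rowSpace_HZ_iff]
      exact ⟨s, rfl, by rw [hs, neg_zero]⟩
    · show A *ᵥ (B *ᵥ s) = 0
      rw [mulVec_mulVec, hAB, ← mulVec_mulVec, hs, mulVec_zero]

/-- `dim(B(ker A)) + dim(ker A ∩ ker B) = dim(ker A)` (rank–nullity of `B` on `ker A`), transported along
`u ↦ (u;0)`. [cite: LinPryadko2024, App. A.6 (arXiv:2306.16400 chunk p0017 L9–13)] -/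
theorem finrank_map_leftEmbed_comp_add (A B : Matrix ι ι F) :
    finrank F ↥((LinearMap.ker A.mulVecLin).map (leftEmbed ∘ₗ B.mulVecLin)) +
      finrank F ↥(LinearMap.ker A.mulVecLin ⊓ LinearMap.ker B.mulVecLin) =
      finrank F ↥(LinearMap.ker A.mulVecLin) := by
  set f := (leftEmbed ∘ₗ B.mulVecLin : (ι → F) →ₗ[F] (ι ⊕ ι → F)) with hf
  have hker : LinearMap.ker f = LinearMap.ker B.mulVecLin := by
    rw [hf, LinearMap.ker_comp_of_ker_eq_bot _ (LinearMap.ker_eq_bot.mpr leftEmbed_injective)]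
  have h1 : finrank F ↥((LinearMap.ker A.mulVecLin).map f) =
      finrank F ↥(LinearMap.range (f.domRestrict (LinearMap.ker A.mulVecLin))) := by
    rw [LinearMap.range_domRestrict]
  have h2 : finrank F ↥(LinearMap.ker A.mulVecLin ⊓ LinearMap.ker B.mulVecLin) =
      finrank F ↥(LinearMap.ker (f.domRestrict (LinearMap.ker A.mulVecLin))) := by
    rw [LinearMap.ker_domRestrict, ← Submodule.finrank_map_subtype_eq, Submodule.map_comap_subtype, hker]
  rw [h1, h2, LinearMap.finrank_range_add_finrank_ker]

/-- **"The rank of the extended matrix `H_Z^{(L)}` equals `ℓ`":** `dim(rs H_Z + (ker A ⊕ 0)) = ℓ` for every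
commuting pair. [cite: LinPryadko2024, App. A.6 "the ranks of the extended matrices H_X^{(L)} and H_Z^{(L)} both equal to ℓ" (arXiv:2306.16400 chunk p0017 L9–11); eq. (26) `H_Z^{(L)}` (chunk p0007 L155–160)] -/
theorem finrank_rowSpace_HZ_sup_kerLeft {A B : Matrix ι ι F} (hAB : A * B = B * A) :
    finrank F ↥(rowSpace (HZ A B) ⊔ (LinearMap.ker A.mulVecLin).map leftEmbed) = Fintype.card ι := by
  have h1 := Submodule.finrank_sup_add_finrank_inf_eq (rowSpace (HZ A B))
    ((LinearMap.ker A.mulVecLin).map leftEmbed)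
  rw [rowSpace_HZ_inf_kerLeft_eq hAB] at h1
  have h2 := finrank_map_leftEmbed_comp_add A B
  have h3 := finrank_ker_inf_ker_eq hAB
  have h4 := rank_HZ_add_kS_add_defectZ hAB
  -- `dim rs H_Z = rank H_Z`
  have h5 : finrank F ↥(rowSpace (HZ A B)) = (HZ A B).rank := by
    have h := finrank_pcCode_add_finrank_rowSpace (HZ A B)
    have h' : (HZ A B).rank + finrank F ↥(pcCode (HZ A B)) = Fintype.card (ι ⊕ ι) := by
      rw [Matrix.rank, pcCode, LinearMap.finrank_range_add_finrank_ker, Module.finrank_fintype_fun_eq_card]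
    omega
  -- `dim (ker A ⊕ 0) = dim ker A = ℓ − rank A`
  have h6 : finrank F ↥((LinearMap.ker A.mulVecLin).map leftEmbed) = finrank F ↥(LinearMap.ker A.mulVecLin) :=
    (Submodule.equivMapOfInjective _ leftEmbed_injective _).finrank_eq.symm
  omega

/-- `rs H_Z + (ker A ⊕ 0) ≤ ker H_X` (the trivial space of `Q₂` consists of `Z`-codewords of `Q`).
[cite: LinPryadko2024, App. A.6 "a non-trivial codeword in Q is necessarily a codeword in Q₂" (arXiv:2306.16400 chunk p0017 L7–9)] -/
theorem rowSpace_HZ_sup_kerLeft_le_pcCode_HX {A B : Matrix ι ι F} (hAB : A * B = B * A) :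
    rowSpace (HZ A B) ⊔ (LinearMap.ker A.mulVecLin).map leftEmbed ≤ pcCode (HX A B) := by
  refine sup_le ?_ ?_
  · intro x hx
    obtain ⟨s, hs⟩ := (mem_rowSpace_iff _ x).1 hx
    rw [← hs, HZ_def, vecMul_fromCols, vecMul_transpose, vecMul_neg, vecMul_transpose]
    rw [mem_pcCode_HX_iff, mulVec_neg, mulVec_mulVec, mulVec_mulVec, hAB, add_neg_cancel]
  · rintro _ ⟨a, ha, rfl⟩
    have ha : A *ᵥ a = 0 := ha
    rw [leftEmbed_apply, mem_pcCode_HX_iff, ha, mulVec_zero, add_zero]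

/-- **`k₂ = k_S + δ_X`:** the dimension of `Q₂ = css(H_X, H_Z^{(L)})`, i.e. `dim ker H_X − dim(rs H_Z + (ker A ⊕ 0))`,
is `k_S + δ_X` (additive form). [cite: LinPryadko2024, App. A.6 "the two codes have dimensions k₁ = k_S + δ_Z and k₂ = k_S + δ_X" (arXiv:2306.16400 chunk p0017 L10–13)] -/
theorem finrank_pcCode_HX_eq_k2 {A B : Matrix ι ι F} (hAB : A * B = B * A) :
    finrank F ↥(pcCode (HX A B)) =
      finrank F ↥(rowSpace (HZ A B) ⊔ (LinearMap.ker A.mulVecLin).map leftEmbed) + (kS A B + defectX A B) := by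
  rw [finrank_rowSpace_HZ_sup_kerLeft hAB]
  have h1 := rank_HX_add_kS_add_defectX hAB
  have h2 : (HX A B).rank + finrank F ↥(pcCode (HX A B)) = Fintype.card (ι ⊕ ι) := by
    rw [Matrix.rank, pcCode, LinearMap.finrank_range_add_finrank_ker, Module.finrank_fintype_fun_eq_card]
  rw [Fintype.card_sum] at h2
  omega

/-- **`k₁ + k₂ = k`:** `(k_S + δ_Z) + (k_S + δ_X) = dim Q` ("adding up to the dimension (two-block-k) of the
code Q"). [cite: LinPryadko2024, App. A.6 (arXiv:2306.16400 chunk p0017 L10–13) with §III.A `k = 2k_S + δ_X + δ_Z` (chunk p0006 L122–126)] -/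
theorem k1_add_k2_eq_dim {A B : Matrix ι ι F} (hAB : A * B = B * A) :
    (kS A B + defectZ A B) + (kS A B + defectX A B) = dim A B := by
  rw [dim_eq hAB]
  ring

end AppASix

end TwoBlock

end Literature.InformationTheory.QuantumCodes
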